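import Literature.NumberTheory.Automorphic.ArchKirillovTestVectorSelectionGL2
import Literature.NumberTheory.Automorphic.ArchKirillovWeightOneGL2Real
import Literature.NumberTheory.Automorphic.ArchKirillovSignsGL2Real
import Literature.NumberTheory.Automorphic.ArchTorusCoordinatesGL2
import HarnessLib

/-!
# Normal form of the base vector of the archimedean Hecke test vector of `GL₂(K_∞)`
# (Jacquet–Langlands (1970), §5–§6: reduction to the minimal `K_∞`-type data)

Topic `NumberTheory/Automorphic`; namespace `Literature.NumberTheory.Automorphic`. One `Prop`-valued
structure (`IsBaseCandidate`, a predicate — not a named fact), one operator (`descentOp`, the `K`-type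
descent of `ArchKTypeDescentGL2Complex` as an element of `End(𝒢)`), theorems otherwise.

Let `τ` be an irreducible unitary strongly continuous representation of `G_∞ = GL₂(K_∞)` on a Hilbert space,
`ℓ ≠ 0` a continuous `ψ_∞`-Whittaker functional on the Gårding space `𝒢`, `S_ℓ` the null space of the
Kirillov map. A **base candidate** is a `K_∞`-finite Gårding vector `x ∉ S_ℓ` which is a joint weight vector
(`τ(W_w) x = ik_w x` at the real places, `τ(T_w) x = im_w x`, `E_w x = 0`, `F_w^{m_w+1} x = 0 ≠ F_w^j x`
(`j ≤ m_w`) at the complex places). This file proves that base candidates exist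
(`ArchKirillovTestVectorSelectionGL2.exists_baseVector`) and can be NORMALISED (`exists_isBaseCandidate_normalForm`):
minimising `Σ_w |k_w| + Σ_w m_w` over all candidates and post-composing with the signs `δ_w`, the lowering
operators and the `δ_w`-symmetrisations, one finds a candidate with

* `k_w ≥ 0` at every real place, and there either `k_w = 0` and `τ(δ_w) x = ± x`, or `k_w = 1` and
  `R_w L_w x ≠ 0` (the "weight-one" type), or `k_w ≥ 1` and `L_w x ∈ S_ℓ` (the "discrete-series" type);
* at every complex place with `m_w ≥ 2`, the `K`-type descent of `x` lies in `S_ℓ` (so that the minimal-type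
  relation of `ArchKTypeDescentKirillovGL2Complex` is available).

The point of working modulo `S_ℓ` is that `S_ℓ` is stable under `U(𝔤)`, the torus and the signs
(`ArchKirillovNullSpaceGL2`), so no `K_∞`-multiplicity-one or `(𝔤, K)`-module theory is needed.

## References

* H. Jacquet, R. P. Langlands, *Automorphic Forms on GL(2)*, LNM 114 (1970), §5 (Lemma 5.6, Thm. 5.13),
  §6 (Thm. 6.2–6.4). [JacquetLanglands1970]
* A. W. Knapp, *Representation Theory of Semisimple Groups*, Princeton 1986, Ch. VIII §2–§3. [Knapp1986]
-/

noncomputable section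

open MeasureTheory Measure NumberField NumberField.InfinitePlace NumberField.mixedEmbedding IsDedekindDomain Set Filter
open scoped MatrixGroups Topology Classical InnerProductSpace

namespace Literature.NumberTheory.Automorphic

variable {K : Type} [Field K] [NumberField K]

-- as in `ArchGardingWhittaker`
set_option backward.isDefEq.respectTransparency false

/-! ### 0. Matrix lemmas: signs and letters at distinct places -/

section Matrices

omit [NumberField K] in
/-- Conjugation by the sign `δ_w = 1 - 2E₀₀ ⊗ 1_w` fixes a matrix killed on both sides by `E₀₀ ⊗ 1_w`.
[folklore] -/
theorem realSign_conj_eq_of_mul_eq_zero (w : {w : InfinitePlace K // IsReal w}) {Y : Matrix (Fin 2) (Fin 2) (mixedSpace K)}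
    (h1 : Matrix.single (0 : Fin 2) (0 : Fin 2) ((Pi.single w 1, 0) : mixedSpace K) * Y = 0)
    (h2 : Y * Matrix.single (0 : Fin 2) (0 : Fin 2) ((Pi.single w 1, 0) : mixedSpace K) = 0) :
    ((1 : Matrix (Fin 2) (Fin 2) (mixedSpace K)) - (2 : ℝ) • Matrix.single (0 : Fin 2) (0 : Fin 2) ((Pi.single w 1, 0) : mixedSpace K)) * Y *
        (1 - (2 : ℝ) • Matrix.single (0 : Fin 2) (0 : Fin 2) ((Pi.single w 1, 0) : mixedSpace K)) = Y := by
  rw [sub_mul, one_mul, smul_mul_assoc, h1, smul_zero, sub_zero, mul_sub, mul_one, mul_smul_comm, h2, smul_zero, sub_zero]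

omit [NumberField K] in
/-- A single-entry matrix with direction `y` is killed on both sides by `E₀₀ ⊗ 1_w` when `1_w y = 0 = y 1_w`.
[folklore] -/
theorem single_realIdem_mul_single_eq_zero (w : {w : InfinitePlace K // IsReal w}) {y : mixedSpace K}
    (hy : ((Pi.single w 1, 0) : mixedSpace K) * y = 0) (hy' : y * ((Pi.single w 1, 0) : mixedSpace K) = 0) (i j : Fin 2) :
    Matrix.single (0 : Fin 2) (0 : Fin 2) ((Pi.single w 1, 0) : mixedSpace K) * Matrix.single i j y = 0 ∧
    Matrix.single i j y * Matrix.single (0 : Fin 2) (0 : Fin 2) ((Pi.single w 1, 0) : mixedSpace K) = 0 :=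
  ⟨single_mul_single_eq_zero_of_mul_eq_zero hy _ _ _ _, single_mul_single_eq_zero_of_mul_eq_zero hy' _ _ _ _⟩

end Matrices

/-! ### 1. Commutation of letters at distinct places; the descent operator -/

section Letters

variable {hcpt : isCompact_glFiniteIntegralLevel 2 K}
  {E : Type*} [NormedAddCommGroup E] [NormedSpace ℂ E] [CompleteSpace E]
  {τ : ContRepresentation ℂ (AutomorphyDatum.gl 2 K hcpt).arch.carrier E}
  (hτ : τ.IsStronglyContinuous)

local notation "D" => gardingEnd (hcpt := hcpt) (τ := τ) hτ

/-- `τ(E_{ij} ⊗ x)` and `τ(E_{kl} ⊗ y)` commute when `xy = 0 = yx` (letters at distinct places). [folklore] -/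
theorem commute_gardingEnd_single_of_mul_eq_zero {x y : mixedSpace K} (hxy : x * y = 0) (hyx : y * x = 0) (i j k l : Fin 2) :
    Commute (D (Matrix.single i j x)) (D (Matrix.single k l y)) := by
  refine gardingEnd_comm_of_bracket_eq_zero hτ ?_
  rw [single_mul_single_eq_zero_of_mul_eq_zero hxy, single_mul_single_eq_zero_of_mul_eq_zero hyx, sub_zero]

/-- `τ(δ_w)` commutes with `τ(E_{ij} ⊗ y)` when `1_w y = 0 = y 1_w` (a sign and a letter at distinct places).
[folklore] -/
theorem commute_gardingAct_realSign_gardingEnd_single {w : {w : InfinitePlace K // IsReal w}} {δ : GL (Fin 2) (mixedSpace K)}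
    (hδ : (δ : Matrix (Fin 2) (Fin 2) (mixedSpace K)) = 1 - (2 : ℝ) • Matrix.single (0 : Fin 2) (0 : Fin 2) ((Pi.single w 1, 0) : mixedSpace K))
    {y : mixedSpace K} (hy : ((Pi.single w 1, 0) : mixedSpace K) * y = 0) (hy' : y * ((Pi.single w 1, 0) : mixedSpace K) = 0)
    (i j : Fin 2) : Commute (gardingAct hτ δ) (D (Matrix.single i j y)) := by
  change gardingAct hτ δ * D (Matrix.single i j y) = D (Matrix.single i j y) * gardingAct hτ δ
  obtain ⟨h1, h2⟩ := single_realIdem_mul_single_eq_zero w hy hy' i j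
  rw [gardingAct_mul_gardingEnd hτ, coe_realSign_inv hδ, hδ, realSign_conj_eq_of_mul_eq_zero w h1 h2]

end Letters

section Place

variable {hcpt : isCompact_glFiniteIntegralLevel 2 K}
  {E : Type*} [NormedAddCommGroup E] [NormedSpace ℂ E] [CompleteSpace E]
  {τ : ContRepresentation ℂ (AutomorphyDatum.gl 2 K hcpt).arch.carrier E}
  (hτ : τ.IsStronglyContinuous) (w : {w : InfinitePlace K // IsComplex w})

local notation "𝐜" => ((0, Pi.single w 1) : mixedSpace K)
local notation "𝐜I" => ((0, Pi.single w Complex.I) : mixedSpace K)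
local notation "D" => gardingEnd (hcpt := hcpt) (τ := τ) hτ
local notation "Dh[" i "," j "]" => (gardingEnd (hcpt := hcpt) (τ := τ) hτ (Matrix.single (i : Fin 2) (j : Fin 2) ((0, Pi.single w 1) : mixedSpace K)) -
  Complex.I • gardingEnd (hcpt := hcpt) (τ := τ) hτ (Matrix.single (i : Fin 2) (j : Fin 2) ((0, Pi.single w Complex.I) : mixedSpace K)))
local notation "Da[" i "," j "]" => (gardingEnd (hcpt := hcpt) (τ := τ) hτ (Matrix.single (i : Fin 2) (j : Fin 2) ((0, Pi.single w 1) : mixedSpace K)) +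
  Complex.I • gardingEnd (hcpt := hcpt) (τ := τ) hτ (Matrix.single (i : Fin 2) (j : Fin 2) ((0, Pi.single w Complex.I) : mixedSpace K)))
local notation "Tc" => (Matrix.single (0 : Fin 2) (0 : Fin 2) ((0, Pi.single w Complex.I) : mixedSpace K) -
  Matrix.single (1 : Fin 2) (1 : Fin 2) ((0, Pi.single w Complex.I) : mixedSpace K))

/-- **The `K`-type descent operator** at the complex place `w` for the torus weight `m`:
`P⁻ - (4m)⁻¹ P⁰ F - (4m(m-1))⁻¹ P⁺ F²` (`ArchKTypeDescentGL2Complex.descent_highest`), as an element of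
`End(𝒢)`. [cite: JacquetLanglands1970, §6] -/
def descentOp (m : ℂ) : Module.End ℂ (archGardingSpace hcpt τ) :=
  (Dh[1,0] + Da[0,1]) - (1 / (4 * m)) • (((2 : ℂ) • (Dh[0,0] - Dh[1,1]) + (2 : ℂ) • (Da[0,0] - Da[1,1])) * (Dh[1,0] - Da[0,1])) -
    (1 / (4 * m * (m - 1))) • ((Dh[0,1] + Da[1,0]) * (Dh[1,0] - Da[0,1]) * (Dh[1,0] - Da[0,1]))

/-- Unfolding of `descentOp` into the vector of `descent_highest`. [folklore] -/
theorem descentOp_apply (m : ℂ) (x : archGardingSpace hcpt τ) :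
    descentOp hτ w m x = (Dh[1,0] + Da[0,1]) x -
      (1 / (4 * m)) • ((2 : ℂ) • (Dh[0,0] - Dh[1,1]) + (2 : ℂ) • (Da[0,0] - Da[1,1])) ((Dh[1,0] - Da[0,1]) x) -
      (1 / (4 * m * (m - 1))) • (Dh[0,1] + Da[1,0]) ((Dh[1,0] - Da[0,1]) ((Dh[1,0] - Da[0,1]) x)) := by
  simp only [descentOp, LinearMap.sub_apply, LinearMap.smul_apply, Module.End.mul_apply]

/-- The descent of a highest-weight vector of torus weight `m ≠ 0, 1` is again highest, of torus weight
`m - 2` (`descent_highest`). [cite: JacquetLanglands1970, §6] -/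
theorem descentOp_highest (m : ℂ) (hm : m ≠ 0) (hm1 : m - 1 ≠ 0) (x : archGardingSpace hcpt τ)
    (hE : (Dh[0,1] - Da[1,0]) x = 0) (hT : D Tc x = (Complex.I * m) • x) :
    (Dh[0,1] - Da[1,0]) (descentOp hτ w m x) = 0 ∧ D Tc (descentOp hτ w m x) = (Complex.I * (m - 2)) • descentOp hτ w m x := by
  rw [descentOp_apply]
  exact descent_highest hτ w m hm hm1 x hE hT

/-- An endomorphism commuting with the eight basic letters `τ(E_{ij} ⊗ c_w)`, `τ(E_{ij} ⊗ ic_w)` of the complex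
place `w` commutes with the descent operator. [folklore] -/
theorem commute_descentOp {Φ : Module.End ℂ (archGardingSpace hcpt τ)}
    (h1 : ∀ i j : Fin 2, Commute Φ (D (Matrix.single i j 𝐜))) (h2 : ∀ i j : Fin 2, Commute Φ (D (Matrix.single i j 𝐜I)))
    (m : ℂ) : Commute Φ (descentOp hτ w m) := by
  have hh : ∀ i j : Fin 2, Commute Φ (Dh[i,j]) := fun i j => (h1 i j).sub_right ((h2 i j).smul_right _)
  have ha : ∀ i j : Fin 2, Commute Φ (Da[i,j]) := fun i j => (h1 i j).add_right ((h2 i j).smul_right _)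
  unfold descentOp
  refine (((hh 1 0).add_right (ha 0 1)).sub_right ?_).sub_right ?_
  · exact ((((hh 0 0).sub_right (hh 1 1)).smul_right _).add_right (((ha 0 0).sub_right (ha 1 1)).smul_right _)).mul_right
      ((hh 1 0).sub_right (ha 0 1)) |>.smul_right _
  · exact ((((hh 0 1).add_right (ha 1 0)).mul_right ((hh 1 0).sub_right (ha 0 1))).mul_right
      ((hh 1 0).sub_right (ha 0 1))).smul_right _

/-- Likewise for the torus letter `τ(T_w)`, the raising operator `E_w = τ^h(E₀₁) - τ^a(E₁₀)` and the lowering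
operator `F_w = τ^h(E₁₀) - τ^a(E₀₁)`. [folklore] -/
theorem commute_torusC_raisingK_loweringK {Φ : Module.End ℂ (archGardingSpace hcpt τ)}
    (h1 : ∀ i j : Fin 2, Commute Φ (D (Matrix.single i j 𝐜))) (h2 : ∀ i j : Fin 2, Commute Φ (D (Matrix.single i j 𝐜I))) :
    Commute Φ (D Tc) ∧ Commute Φ (Dh[0,1] - Da[1,0]) ∧ Commute Φ (Dh[1,0] - Da[0,1]) := by
  have hh : ∀ i j : Fin 2, Commute Φ (Dh[i,j]) := fun i j => (h1 i j).sub_right ((h2 i j).smul_right _)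
  have ha : ∀ i j : Fin 2, Commute Φ (Da[i,j]) := fun i j => (h1 i j).add_right ((h2 i j).smul_right _)
  refine ⟨?_, (hh 0 1).sub_right (ha 1 0), (hh 1 0).sub_right (ha 0 1)⟩
  rw [gardingEnd_sub]
  exact (h2 0 0).sub_right (h2 1 1)

end Place

/-! ### 2. `K_∞`-finite Gårding vectors; the signs `δ_w` -/

section KFinite

variable {hcpt : isCompact_glFiniteIntegralLevel 2 K}
  {E : Type*} [NormedAddCommGroup E] [InnerProductSpace ℂ E] [CompleteSpace E]
  {τ : ContRepresentation ℂ (AutomorphyDatum.gl 2 K hcpt).arch.carrier E}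
  (hτ : τ.IsStronglyContinuous)

/-- **The `K_∞`-finite Gårding vectors**: those lying in a finite-dimensional `K_∞`-stable subspace of `𝒢`;
a subspace. [cite: Knapp1986, Ch. VIII §2] -/
def archKFinite : Submodule ℂ (archGardingSpace hcpt τ) where
  carrier := {v | ∃ V : Submodule ℂ (archGardingSpace hcpt τ), FiniteDimensional ℂ V ∧
    (∀ κ ∈ Kinf 2 K, ∀ u ∈ V, gardingAct hτ κ u ∈ V) ∧ v ∈ V}
  zero_mem' := ⟨⊥, inferInstance, fun κ _ u hu => by
    rw [(Submodule.mem_bot ℂ).1 hu, map_zero]; exact Submodule.zero_mem _, Submodule.zero_mem _⟩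
  add_mem' := by
    rintro a b ⟨V₁, h1, hK1, ha⟩ ⟨V₂, h2, hK2, hb⟩
    haveI := h1; haveI := h2
    refine ⟨V₁ ⊔ V₂, inferInstance, fun κ hκ u hu => ?_, Submodule.add_mem_sup ha hb⟩
    obtain ⟨u₁, hu₁, u₂, hu₂, rfl⟩ := Submodule.mem_sup.1 hu
    rw [map_add]
    exact Submodule.add_mem_sup (hK1 κ hκ u₁ hu₁) (hK2 κ hκ u₂ hu₂)
  smul_mem' := by
    rintro c v ⟨V, h, hK, hv⟩
    exact ⟨V, h, hK, V.smul_mem c hv⟩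

/-- Membership in `archKFinite`. [folklore] -/
theorem mem_archKFinite_iff {v : archGardingSpace hcpt τ} :
    v ∈ archKFinite hτ ↔ ∃ V : Submodule ℂ (archGardingSpace hcpt τ), FiniteDimensional ℂ V ∧
      (∀ κ ∈ Kinf 2 K, ∀ u ∈ V, gardingAct hτ κ u ∈ V) ∧ v ∈ V := Iff.rfl

/-- `archKFinite` is `τ(X)`-stable for every `X ∈ 𝔤` (`ArchGardingFiniteDimStable`). [cite: Knapp1986, Ch. VIII §2] -/
theorem gardingEnd_mem_archKFinite (X : Matrix (Fin 2) (Fin 2) (mixedSpace K)) {v : archGardingSpace hcpt τ}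
    (hv : v ∈ archKFinite hτ) : gardingEnd hτ X v ∈ archKFinite hτ := by
  obtain ⟨V, hVfd, hK, hvV⟩ := hv
  haveI := hVfd
  obtain ⟨W, hWfd, hKW, -, hW⟩ := exists_kStable_finiteDimensional_forall_gardingEnd_mem hτ V hK
  exact ⟨W, hWfd, hKW, hW X v hvV⟩

/-- `archKFinite` is `τ(κ)`-stable for `κ ∈ K_∞`. [folklore] -/
theorem gardingAct_mem_archKFinite {κ : GL (Fin 2) (mixedSpace K)} (hκ : κ ∈ Kinf 2 K) {v : archGardingSpace hcpt τ}
    (hv : v ∈ archKFinite hτ) : gardingAct hτ κ v ∈ archKFinite hτ := by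
  obtain ⟨V, hVfd, hK, hvV⟩ := hv
  exact ⟨V, hVfd, hK, hK κ hκ v hvV⟩

variable {w : {w : InfinitePlace K // IsReal w}} {δ : GL (Fin 2) (mixedSpace K)}
  (hδ : (δ : Matrix (Fin 2) (Fin 2) (mixedSpace K)) = 1 - (2 : ℝ) • Matrix.single (0 : Fin 2) (0 : Fin 2) ((Pi.single w 1, 0) : mixedSpace K))
include hδ

omit hτ in
/-- The sign `δ_w` lies in `K_∞` (it is unitary for the involution of `M₂(K_∞)`). [folklore] -/
theorem realSign_mem_Kinf : δ ∈ Kinf 2 K := by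
  refine ⟨Subgroup.mem_top _, ?_⟩
  change δ ∈ unitarySubgroupGL (mixedSpace K) (Fin 2)
  rw [mem_unitarySubgroupGL_iff_coe_mem_unitaryGroup, Matrix.mem_unitaryGroup_iff, hδ]
  have hstar : star ((1 : Matrix (Fin 2) (Fin 2) (mixedSpace K)) - (2 : ℝ) • Matrix.single (0 : Fin 2) (0 : Fin 2) ((Pi.single w 1, 0) : mixedSpace K)) =
      1 - (2 : ℝ) • Matrix.single (0 : Fin 2) (0 : Fin 2) ((Pi.single w 1, 0) : mixedSpace K) := by
    rw [star_sub, star_one, star_smul, star_trivial, Matrix.star_eq_conjTranspose, Matrix.conjTranspose_single,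
      star_realIdem]
  rw [hstar, realSign_mul_realSign]

omit hτ in
/-- `δ_w = diag(-1_w, 1)`. [folklore] -/
theorem realSign_eq_diagGL2 : δ = diagGL2 (realUnitAt K w (-1)) 1 := by
  have h := diagGL2_realUnitAt_of_neg (K := K) hδ (x := -1) (by simp)
  rw [h, Units.val_neg, Units.val_one, abs_neg, abs_one, Real.log_one, zero_smul, expGL_zero, one_mul]

/-- `S_ℓ` is `τ(δ_w)`-stable, in `iff` form (`τ(δ_w)² = 1`). [folklore] -/
theorem gardingAct_realSign_mem_kirillovNull_iff (ℓ : archGardingSpace hcpt τ →ₗ[ℂ] ℂ) (v : archGardingSpace hcpt τ) :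
    gardingAct hτ δ v ∈ kirillovNull hτ ℓ ↔ v ∈ kirillovNull hτ ℓ := by
  refine ⟨fun h => ?_, gardingAct_mem_kirillovNull_of_eq_diagGL2 hτ ℓ (realSign_eq_diagGL2 hδ)⟩
  have h2 := gardingAct_mem_kirillovNull_of_eq_diagGL2 hτ ℓ (realSign_eq_diagGL2 hδ) h
  rwa [← Module.End.mul_apply, gardingAct_realSign_mul_self hτ hδ, Module.End.one_apply] at h2

end KFinite

/-! ### 3. Base candidates -/

section Candidates

variable {hcpt : isCompact_glFiniteIntegralLevel 2 K}
  {E : Type*} [NormedAddCommGroup E] [InnerProductSpace ℂ E] [CompleteSpace E]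
  {τ : ContRepresentation ℂ (AutomorphyDatum.gl 2 K hcpt).arch.carrier E}
  (hτ : τ.IsStronglyContinuous)

local notation "D" => gardingEnd (hcpt := hcpt) (τ := τ) hτ
local notation "W[" w "]" => (Matrix.single (0 : Fin 2) (1 : Fin 2) ((Pi.single w 1, 0) : mixedSpace K) -
  Matrix.single (1 : Fin 2) (0 : Fin 2) ((Pi.single w 1, 0) : mixedSpace K))
local notation "T[" w "]" => (Matrix.single (0 : Fin 2) (0 : Fin 2) ((0, Pi.single w Complex.I) : mixedSpace K) -
  Matrix.single (1 : Fin 2) (1 : Fin 2) ((0, Pi.single w Complex.I) : mixedSpace K))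
local notation "Eup[" w "]" => ((gardingEnd (hcpt := hcpt) (τ := τ) hτ (Matrix.single (0 : Fin 2) (1 : Fin 2) ((0, Pi.single w 1) : mixedSpace K)) -
    Complex.I • gardingEnd (hcpt := hcpt) (τ := τ) hτ (Matrix.single (0 : Fin 2) (1 : Fin 2) ((0, Pi.single w Complex.I) : mixedSpace K))) -
  (gardingEnd (hcpt := hcpt) (τ := τ) hτ (Matrix.single (1 : Fin 2) (0 : Fin 2) ((0, Pi.single w 1) : mixedSpace K)) +
    Complex.I • gardingEnd (hcpt := hcpt) (τ := τ) hτ (Matrix.single (1 : Fin 2) (0 : Fin 2) ((0, Pi.single w Complex.I) : mixedSpace K))))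
local notation "Flo[" w "]" => ((gardingEnd (hcpt := hcpt) (τ := τ) hτ (Matrix.single (1 : Fin 2) (0 : Fin 2) ((0, Pi.single w 1) : mixedSpace K)) -
    Complex.I • gardingEnd (hcpt := hcpt) (τ := τ) hτ (Matrix.single (1 : Fin 2) (0 : Fin 2) ((0, Pi.single w Complex.I) : mixedSpace K))) -
  (gardingEnd (hcpt := hcpt) (τ := τ) hτ (Matrix.single (0 : Fin 2) (1 : Fin 2) ((0, Pi.single w 1) : mixedSpace K)) +
    Complex.I • gardingEnd (hcpt := hcpt) (τ := τ) hτ (Matrix.single (0 : Fin 2) (1 : Fin 2) ((0, Pi.single w Complex.I) : mixedSpace K))))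
local notation "H₀[" w "]" => Matrix.single (0 : Fin 2) (0 : Fin 2) ((Pi.single w 1, 0) : mixedSpace K)
local notation "H₁[" w "]" => Matrix.single (1 : Fin 2) (1 : Fin 2) ((Pi.single w 1, 0) : mixedSpace K)
local notation "X⁺[" w "]" => Matrix.single (0 : Fin 2) (1 : Fin 2) ((Pi.single w 1, 0) : mixedSpace K)
local notation "X⁻[" w "]" => Matrix.single (1 : Fin 2) (0 : Fin 2) ((Pi.single w 1, 0) : mixedSpace K)
local notation "Lo[" w "]" => (gardingEnd (hcpt := hcpt) (τ := τ) hτ (H₀[w] - H₁[w]) - Complex.I • gardingEnd (hcpt := hcpt) (τ := τ) hτ (X⁺[w] + X⁻[w]))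
local notation "Ra[" w "]" => (gardingEnd (hcpt := hcpt) (τ := τ) hτ (H₀[w] - H₁[w]) + Complex.I • gardingEnd (hcpt := hcpt) (τ := τ) hτ (X⁺[w] + X⁻[w]))

variable (ℓ : archGardingSpace hcpt τ →ₗ[ℂ] ℂ)

/-- **Base candidates** for the archimedean Hecke test vector: a `K_∞`-finite Gårding vector outside the
null space `S_ℓ` of the Kirillov map which is a joint weight vector — weights `ik_w` under `τ(W_w)` at the
real places; torus weights `im_w`, highest (`E_w x = 0`) with a string of exact length `m_w + 1` at the complex
places. (Jacquet–Langlands (1970), §5–§6: the vectors of a `K_∞`-type.) [cite: JacquetLanglands1970, §5–§6] -/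
structure IsBaseCandidate (x : archGardingSpace hcpt τ) (k : {w : InfinitePlace K // IsReal w} → ℤ)
    (m : {w : InfinitePlace K // IsComplex w} → ℕ) : Prop where
  kFinite : x ∈ archKFinite hτ
  not_mem : x ∉ kirillovNull hτ ℓ
  weylR : ∀ w, D W[w] x = (Complex.I * k w) • x
  torusC : ∀ w, D T[w] x = (Complex.I * m w) • x
  raising : ∀ w, Eup[w] x = 0
  lowering_pow : ∀ w, (Flo[w] ^ (m w + 1)) x = 0
  lowering_pow_ne : ∀ w, ∀ j ≤ m w, (Flo[w] ^ j) x ≠ 0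

variable {ℓ}

/-- A base candidate is non-zero. [folklore] -/
theorem IsBaseCandidate.ne_zero {x : archGardingSpace hcpt τ} {k : {w : InfinitePlace K // IsReal w} → ℤ}
    {m : {w : InfinitePlace K // IsComplex w} → ℕ} (h : IsBaseCandidate hτ ℓ x k m) : x ≠ 0 := by
  rintro rfl
  exact h.not_mem (Submodule.zero_mem _)

/-- **The string lengths are forced**: a non-zero `K_∞`-finite Gårding vector, highest of torus weight `im_w`
(`m_w ∈ ℕ`) at every complex place, has strings of exact length `m_w + 1`
(`ArchKTypeDescentGL2Complex.exists_nat_weight_of_highest`). [cite: JacquetLanglands1970, §6] -/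
theorem lowering_pow_of_highest {V : Submodule ℂ (archGardingSpace hcpt τ)} [FiniteDimensional ℂ V]
    (hK : ∀ κ ∈ Kinf 2 K, ∀ v ∈ V, gardingAct hτ κ v ∈ V) {x : archGardingSpace hcpt τ} (hxV : x ∈ V) (hx : x ≠ 0)
    (m : {w : InfinitePlace K // IsComplex w} → ℕ) (hT : ∀ w, D T[w] x = (Complex.I * m w) • x)
    (hE : ∀ w, Eup[w] x = 0) :
    (∀ w, (Flo[w] ^ (m w + 1)) x = 0) ∧ ∀ w, ∀ j ≤ m w, (Flo[w] ^ j) x ≠ 0 := by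
  have key : ∀ w, (Flo[w] ^ (m w + 1)) x = 0 ∧ ∀ j ≤ m w, (Flo[w] ^ j) x ≠ 0 := by
    intro w
    obtain ⟨m', hm', h1, h2⟩ := exists_nat_weight_of_highest hτ w hK hxV hx (hE w) (hT w)
    have hmm : m' = m w := by
      have h := mul_left_cancel₀ Complex.I_ne_zero hm'.symm
      exact_mod_cast h
    subst hmm
    exact ⟨h1, h2⟩
  exact ⟨fun w => (key w).1, fun w => (key w).2⟩

/-- **Constructor**: `K_∞`-finiteness, `x ∉ S_ℓ` and the weight/highest conditions already make a base
candidate. [folklore] -/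
theorem IsBaseCandidate.of_highest {x : archGardingSpace hcpt τ} {k : {w : InfinitePlace K // IsReal w} → ℤ}
    {m : {w : InfinitePlace K // IsComplex w} → ℕ}
    (hV : x ∈ archKFinite hτ)
    (hS : x ∉ kirillovNull hτ ℓ) (hW : ∀ w, D W[w] x = (Complex.I * k w) • x)
    (hT : ∀ w, D T[w] x = (Complex.I * m w) • x) (hE : ∀ w, Eup[w] x = 0) : IsBaseCandidate hτ ℓ x k m := by
  obtain ⟨V, hVfd, hK, hxV⟩ := hV
  haveI := hVfd
  have hx : x ≠ 0 := by rintro rfl; exact hS (Submodule.zero_mem _)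
  obtain ⟨h1, h2⟩ := lowering_pow_of_highest hτ hK hxV hx m hT hE
  exact ⟨⟨V, hVfd, hK, hxV⟩, hS, hW, hT, hE, h1, h2⟩

/-! ### Commutation helpers -/

/-- An endomorphism commuting with the four basic letters of the real place `w` commutes with `τ(W_w)`,
`L_w`, `R_w`. [folklore] -/
theorem commute_weylR_lowering_raising (w : {w : InfinitePlace K // IsReal w}) {Φ : Module.End ℂ (archGardingSpace hcpt τ)}
    (hΦ : ∀ i j : Fin 2, Commute Φ (D (Matrix.single i j ((Pi.single w 1, 0) : mixedSpace K)))) :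
    Commute Φ (D W[w]) ∧ Commute Φ (Lo[w]) ∧ Commute Φ (Ra[w]) := by
  have hW : Commute Φ (D W[w]) := by rw [gardingEnd_sub]; exact (hΦ 0 1).sub_right (hΦ 1 0)
  have hH : Commute Φ (D (H₀[w] - H₁[w])) := by rw [gardingEnd_sub]; exact (hΦ 0 0).sub_right (hΦ 1 1)
  have hX : Commute Φ (D (X⁺[w] + X⁻[w])) := by rw [gardingEnd_add]; exact (hΦ 0 1).add_right (hΦ 1 0)
  exact ⟨hW, hH.sub_right (hX.smul_right _), hH.add_right (hX.smul_right _)⟩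

/-- Basic letters at two distinct real places commute. [folklore] -/
theorem commute_gardingEnd_single_realIdem_of_ne {w w' : {w : InfinitePlace K // IsReal w}} (h : w ≠ w') (i j k l : Fin 2) :
    Commute (D (Matrix.single i j ((Pi.single w 1, 0) : mixedSpace K))) (D (Matrix.single k l ((Pi.single w' 1, 0) : mixedSpace K))) :=
  commute_gardingEnd_single_of_mul_eq_zero hτ (realIdem_mul_realIdem_of_ne h) (realIdem_mul_realIdem_of_ne (Ne.symm h)) i j k l

/-- Basic letters at a real and a complex place commute. [folklore] -/
theorem commute_gardingEnd_single_realIdem_inr (w : {w : InfinitePlace K // IsReal w}) (w' : {w : InfinitePlace K // IsComplex w})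
    (a : ℂ) (i j k l : Fin 2) :
    Commute (D (Matrix.single i j ((Pi.single w 1, 0) : mixedSpace K))) (D (Matrix.single k l ((0, Pi.single w' a) : mixedSpace K))) :=
  commute_gardingEnd_single_of_mul_eq_zero hτ (realIdem_mul_inr w _) (inr_mul_realIdem w _) i j k l

/-- Basic letters at two distinct complex places commute. [folklore] -/
theorem commute_gardingEnd_single_inr_of_ne {w w' : {w : InfinitePlace K // IsComplex w}} (h : w ≠ w') (a b : ℂ) (i j k l : Fin 2) :
    Commute (D (Matrix.single i j ((0, Pi.single w a) : mixedSpace K))) (D (Matrix.single k l ((0, Pi.single w' b) : mixedSpace K))) :=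
  commute_gardingEnd_single_of_mul_eq_zero hτ (inrSingle_mul_inrSingle_of_ne h a b) (inrSingle_mul_inrSingle_of_ne (Ne.symm h) b a) i j k l

/-- `L_w`, `R_w` commute with the basic letters of the other real places and of the complex places.
[folklore] -/
theorem commute_lowering_raising_letters (w : {w : InfinitePlace K // IsReal w}) :
    (∀ w', w' ≠ w → ∀ i j : Fin 2, Commute (Lo[w]) (D (Matrix.single i j ((Pi.single w' 1, 0) : mixedSpace K))) ∧
      Commute (Ra[w]) (D (Matrix.single i j ((Pi.single w' 1, 0) : mixedSpace K)))) ∧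
    ∀ (w'' : {w : InfinitePlace K // IsComplex w}) (a : ℂ) (i j : Fin 2),
      Commute (Lo[w]) (D (Matrix.single i j ((0, Pi.single w'' a) : mixedSpace K))) ∧
      Commute (Ra[w]) (D (Matrix.single i j ((0, Pi.single w'' a) : mixedSpace K))) := by
  refine ⟨fun w' hw' i j => ?_, fun w'' a i j => ?_⟩
  · obtain ⟨-, h1, h2⟩ := commute_weylR_lowering_raising hτ w
      (Φ := D (Matrix.single i j ((Pi.single w' 1, 0) : mixedSpace K)))
      (fun k l => commute_gardingEnd_single_realIdem_of_ne hτ hw' i j k l)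
    exact ⟨h1.symm, h2.symm⟩
  · obtain ⟨-, h1, h2⟩ := commute_weylR_lowering_raising hτ w
      (Φ := D (Matrix.single i j ((0, Pi.single w'' a) : mixedSpace K)))
      (fun k l => (commute_gardingEnd_single_realIdem_inr hτ w w'' a k l i j).symm)
    exact ⟨h1.symm, h2.symm⟩

/-- `τ(δ_w)` commutes with the basic letters of the other real places and of the complex places.
[folklore] -/
theorem commute_gardingAct_realSign_letters {w : {w : InfinitePlace K // IsReal w}} {δ : GL (Fin 2) (mixedSpace K)}
    (hδ : (δ : Matrix (Fin 2) (Fin 2) (mixedSpace K)) = 1 - (2 : ℝ) • Matrix.single (0 : Fin 2) (0 : Fin 2) ((Pi.single w 1, 0) : mixedSpace K)) :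
    (∀ w', w' ≠ w → ∀ i j : Fin 2, Commute (gardingAct hτ δ) (D (Matrix.single i j ((Pi.single w' 1, 0) : mixedSpace K)))) ∧
    ∀ (w'' : {w : InfinitePlace K // IsComplex w}) (a : ℂ) (i j : Fin 2),
      Commute (gardingAct hτ δ) (D (Matrix.single i j ((0, Pi.single w'' a) : mixedSpace K))) :=
  ⟨fun _ hw' i j => commute_gardingAct_realSign_gardingEnd_single hτ hδ (realIdem_mul_realIdem_of_ne (Ne.symm hw'))
      (realIdem_mul_realIdem_of_ne hw') i j,
    fun w'' a i j => commute_gardingAct_realSign_gardingEnd_single hτ hδ (realIdem_mul_inr w (Pi.single w'' a))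
      (inr_mul_realIdem w (Pi.single w'' a)) i j⟩

/-- The descent operator of the complex place `w` commutes with the basic letters of the real places and of
the other complex places. [folklore] -/
theorem commute_descentOp_letters (w : {w : InfinitePlace K // IsComplex w}) (mc : ℂ) :
    (∀ (w' : {w : InfinitePlace K // IsReal w}) (i j : Fin 2),
      Commute (descentOp hτ w mc) (D (Matrix.single i j ((Pi.single w' 1, 0) : mixedSpace K)))) ∧
    ∀ w'', w'' ≠ w → ∀ (a : ℂ) (i j : Fin 2),
      Commute (descentOp hτ w mc) (D (Matrix.single i j ((0, Pi.single w'' a) : mixedSpace K))) := by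
  refine ⟨fun w' i j => ?_, fun w'' hw'' a i j => ?_⟩
  · exact (commute_descentOp hτ w (Φ := D (Matrix.single i j ((Pi.single w' 1, 0) : mixedSpace K)))
      (fun k l => commute_gardingEnd_single_realIdem_inr hτ w' w 1 i j k l)
      (fun k l => commute_gardingEnd_single_realIdem_inr hτ w' w Complex.I i j k l) mc).symm
  · exact (commute_descentOp hτ w (Φ := D (Matrix.single i j ((0, Pi.single w'' a) : mixedSpace K)))
      (fun k l => commute_gardingEnd_single_inr_of_ne hτ hw'' a 1 i j k l)
      (fun k l => commute_gardingEnd_single_inr_of_ne hτ hw'' a Complex.I i j k l) mc).symm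

/-! ### Transport of base candidates -/

variable (hτu : τ.IsUnitary) (hτi : τ.IsTopIrreducible) (hℓW : IsArchContWhittakerFunctional hcpt τ hτ ℓ)

/-- **Transport at a real place**: if `Φ ∈ End(𝒢)` commutes with the letters of all other places, `Φ x` is
`K_∞`-finite and outside `S_ℓ`, and `τ(W_w) Φ x = ik₀ Φ x`, then `Φ x` is again a base candidate, with the weight
at `w` replaced by `k₀`. [folklore] -/
theorem IsBaseCandidate.map_real {x : archGardingSpace hcpt τ} {k : {w : InfinitePlace K // IsReal w} → ℤ}
    {m : {w : InfinitePlace K // IsComplex w} → ℕ} (h : IsBaseCandidate hτ ℓ x k m)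
    (w : {w : InfinitePlace K // IsReal w}) {Φ : Module.End ℂ (archGardingSpace hcpt τ)}
    (hfin : Φ x ∈ archKFinite hτ) (hS : Φ x ∉ kirillovNull hτ ℓ)
    (hR : ∀ w', w' ≠ w → ∀ i j : Fin 2, Commute Φ (D (Matrix.single i j ((Pi.single w' 1, 0) : mixedSpace K))))
    (hC : ∀ (w'' : {w : InfinitePlace K // IsComplex w}) (a : ℂ) (i j : Fin 2),
      Commute Φ (D (Matrix.single i j ((0, Pi.single w'' a) : mixedSpace K))))
    {k₀ : ℤ} (hWw : D W[w] (Φ x) = (Complex.I * k₀) • Φ x) :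
    IsBaseCandidate hτ ℓ (Φ x) (Function.update k w k₀) m := by
  refine IsBaseCandidate.of_highest hτ hfin hS (fun w' => ?_) (fun w'' => ?_) (fun w'' => ?_)
  · by_cases hw' : w' = w
    · subst hw'; rw [Function.update_self]; exact hWw
    · rw [Function.update_of_ne hw']
      have hc : Commute Φ (D W[w']) := (commute_weylR_lowering_raising hτ w' (hR w' hw')).1
      rw [← Module.End.mul_apply, ← hc.eq, Module.End.mul_apply, h.weylR w', map_smul]
  · have hc := (commute_torusC_raisingK_loweringK hτ w'' (fun i j => hC w'' 1 i j) (fun i j => hC w'' Complex.I i j)).1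
    rw [← Module.End.mul_apply, ← hc.eq, Module.End.mul_apply, h.torusC w'', map_smul]
  · have hc := (commute_torusC_raisingK_loweringK hτ w'' (fun i j => hC w'' 1 i j) (fun i j => hC w'' Complex.I i j)).2.1
    rw [← Module.End.mul_apply, ← hc.eq, Module.End.mul_apply, h.raising w'', map_zero]

/-- **Transport at a complex place** (same, with the torus weight and the highest-weight condition at `w`
supplied). [folklore] -/
theorem IsBaseCandidate.map_complex {x : archGardingSpace hcpt τ} {k : {w : InfinitePlace K // IsReal w} → ℤ}
    {m : {w : InfinitePlace K // IsComplex w} → ℕ} (h : IsBaseCandidate hτ ℓ x k m)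
    (w : {w : InfinitePlace K // IsComplex w}) {Φ : Module.End ℂ (archGardingSpace hcpt τ)}
    (hfin : Φ x ∈ archKFinite hτ) (hS : Φ x ∉ kirillovNull hτ ℓ)
    (hR : ∀ (w' : {w : InfinitePlace K // IsReal w}) (i j : Fin 2),
      Commute Φ (D (Matrix.single i j ((Pi.single w' 1, 0) : mixedSpace K))))
    (hC : ∀ w'', w'' ≠ w → ∀ (a : ℂ) (i j : Fin 2), Commute Φ (D (Matrix.single i j ((0, Pi.single w'' a) : mixedSpace K))))
    {m₀ : ℕ} (hTw : D T[w] (Φ x) = (Complex.I * m₀) • Φ x) (hEw : Eup[w] (Φ x) = 0) :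
    IsBaseCandidate hτ ℓ (Φ x) k (Function.update m w m₀) := by
  refine IsBaseCandidate.of_highest hτ hfin hS (fun w' => ?_) (fun w'' => ?_) (fun w'' => ?_)
  · have hc : Commute Φ (D W[w']) := (commute_weylR_lowering_raising hτ w' (hR w')).1
    rw [← Module.End.mul_apply, ← hc.eq, Module.End.mul_apply, h.weylR w', map_smul]
  · by_cases hw : w'' = w
    · subst hw; rw [Function.update_self]; exact hTw
    · rw [Function.update_of_ne hw]
      have hc := (commute_torusC_raisingK_loweringK hτ w'' (fun i j => hC w'' hw 1 i j) (fun i j => hC w'' hw Complex.I i j)).1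
      rw [← Module.End.mul_apply, ← hc.eq, Module.End.mul_apply, h.torusC w'', map_smul]
  · by_cases hw : w'' = w
    · subst hw; exact hEw
    · have hc := (commute_torusC_raisingK_loweringK hτ w'' (fun i j => hC w'' hw 1 i j) (fun i j => hC w'' hw Complex.I i j)).2.1
      rw [← Module.End.mul_apply, ← hc.eq, Module.End.mul_apply, h.raising w'', map_zero]

/-- **Lowering at a real place**: if `L_w x ∉ S_ℓ` then `L_w x` is a base candidate of weight `k_w - 2` at `w`.
[cite: JacquetLanglands1970, §5 (Lemma 5.6)] -/
theorem IsBaseCandidate.lowering {x : archGardingSpace hcpt τ} {k : {w : InfinitePlace K // IsReal w} → ℤ}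
    {m : {w : InfinitePlace K // IsComplex w} → ℕ} (h : IsBaseCandidate hτ ℓ x k m)
    (w : {w : InfinitePlace K // IsReal w}) (hS : Lo[w] x ∉ kirillovNull hτ ℓ) :
    IsBaseCandidate hτ ℓ (Lo[w] x) (Function.update k w (k w - 2)) m := by
  obtain ⟨hR, hC⟩ := commute_lowering_raising_letters hτ w
  refine h.map_real hτ w ?_ hS (fun w' hw' i j => (hR w' hw' i j).1) (fun w'' a i j => (hC w'' a i j).1) ?_
  · rw [LinearMap.sub_apply, LinearMap.smul_apply]
    exact Submodule.sub_mem _ (gardingEnd_mem_archKFinite hτ _ h.kFinite)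
      (Submodule.smul_mem _ _ (gardingEnd_mem_archKFinite hτ _ h.kFinite))
  · have h1 := rotGen_lowering_apply hτ w (k w) x (h.weylR w)
    rw [h1]
    push_cast
    ring_nf

/-- **Raising at a real place**: if `R_w x ∉ S_ℓ` then `R_w x` is a base candidate of weight `k_w + 2` at `w`.
[cite: JacquetLanglands1970, §5 (Lemma 5.6)] -/
theorem IsBaseCandidate.raising' {x : archGardingSpace hcpt τ} {k : {w : InfinitePlace K // IsReal w} → ℤ}
    {m : {w : InfinitePlace K // IsComplex w} → ℕ} (h : IsBaseCandidate hτ ℓ x k m)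
    (w : {w : InfinitePlace K // IsReal w}) (hS : Ra[w] x ∉ kirillovNull hτ ℓ) :
    IsBaseCandidate hτ ℓ (Ra[w] x) (Function.update k w (k w + 2)) m := by
  obtain ⟨hR, hC⟩ := commute_lowering_raising_letters hτ w
  refine h.map_real hτ w ?_ hS (fun w' hw' i j => (hR w' hw' i j).2) (fun w'' a i j => (hC w'' a i j).2) ?_
  · rw [LinearMap.add_apply, LinearMap.smul_apply]
    exact Submodule.add_mem _ (gardingEnd_mem_archKFinite hτ _ h.kFinite)
      (Submodule.smul_mem _ _ (gardingEnd_mem_archKFinite hτ _ h.kFinite))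
  · have h1 := rotGen_raising_apply hτ w (k w) x (h.weylR w)
    rw [h1]
    push_cast
    ring_nf

/-- **Sign at a real place**: `τ(δ_w) x` is a base candidate of weight `-k_w` at `w`. [folklore] -/
theorem IsBaseCandidate.realSign {x : archGardingSpace hcpt τ} {k : {w : InfinitePlace K // IsReal w} → ℤ}
    {m : {w : InfinitePlace K // IsComplex w} → ℕ} (h : IsBaseCandidate hτ ℓ x k m)
    (w : {w : InfinitePlace K // IsReal w}) {δ : GL (Fin 2) (mixedSpace K)}
    (hδ : (δ : Matrix (Fin 2) (Fin 2) (mixedSpace K)) = 1 - (2 : ℝ) • Matrix.single (0 : Fin 2) (0 : Fin 2) ((Pi.single w 1, 0) : mixedSpace K)) :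
    IsBaseCandidate hτ ℓ (gardingAct hτ δ x) (Function.update k w (-k w)) m := by
  obtain ⟨hR, hC⟩ := commute_gardingAct_realSign_letters hτ hδ
  refine h.map_real hτ w (gardingAct_mem_archKFinite hτ (realSign_mem_Kinf hδ) h.kFinite)
    (fun h' => h.not_mem ((gardingAct_realSign_mem_kirillovNull_iff hτ hδ ℓ x).1 h')) hR hC ?_
  have h1 := realSign_weight hτ hδ (h.weylR w)
  rw [h1]
  push_cast
  ring_nf

/-- **Symmetrisation at a real place of weight `0`**: `x + ε τ(δ_w) x`, if outside `S_ℓ`, is a base candidate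
with the same weights. [folklore] -/
theorem IsBaseCandidate.realSign_symm {x : archGardingSpace hcpt τ} {k : {w : InfinitePlace K // IsReal w} → ℤ}
    {m : {w : InfinitePlace K // IsComplex w} → ℕ} (h : IsBaseCandidate hτ ℓ x k m)
    (w : {w : InfinitePlace K // IsReal w}) {δ : GL (Fin 2) (mixedSpace K)}
    (hδ : (δ : Matrix (Fin 2) (Fin 2) (mixedSpace K)) = 1 - (2 : ℝ) • Matrix.single (0 : Fin 2) (0 : Fin 2) ((Pi.single w 1, 0) : mixedSpace K))
    (hk : k w = 0) (ε : ℂ) (hS : x + ε • gardingAct hτ δ x ∉ kirillovNull hτ ℓ) :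
    IsBaseCandidate hτ ℓ (x + ε • gardingAct hτ δ x) k m := by
  obtain ⟨hR, hC⟩ := commute_gardingAct_realSign_letters hτ hδ
  have hΦ : (1 + ε • gardingAct hτ δ) x = x + ε • gardingAct hτ δ x := by
    rw [LinearMap.add_apply, Module.End.one_apply, LinearMap.smul_apply]
  have key := h.map_real hτ w (Φ := 1 + ε • gardingAct hτ δ) (k₀ := k w) ?_ ?_
    (fun w' hw' i j => (Commute.one_left _).add_left ((hR w' hw' i j).smul_left ε))
    (fun w'' a i j => (Commute.one_left _).add_left ((hC w'' a i j).smul_left ε)) ?_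
  · rwa [hΦ, Function.update_eq_self] at key
  · rw [hΦ]
    exact Submodule.add_mem _ h.kFinite (Submodule.smul_mem _ _ (gardingAct_mem_archKFinite hτ (realSign_mem_Kinf hδ) h.kFinite))
  · rwa [hΦ]
  · rw [hΦ, map_add, map_smul, realSign_weight hτ hδ (h.weylR w), h.weylR w, hk]
    simp

/-- **Descent at a complex place**: if `m_w ≥ 2` and the `K`-type descent of `x` is outside `S_ℓ`, it is a base
candidate of torus weight `m_w - 2` at `w`. [cite: JacquetLanglands1970, §6] -/
theorem IsBaseCandidate.descent {x : archGardingSpace hcpt τ} {k : {w : InfinitePlace K // IsReal w} → ℤ}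
    {m : {w : InfinitePlace K // IsComplex w} → ℕ} (h : IsBaseCandidate hτ ℓ x k m)
    (w : {w : InfinitePlace K // IsComplex w}) (h2 : 2 ≤ m w) (hS : descentOp hτ w (m w) x ∉ kirillovNull hτ ℓ) :
    IsBaseCandidate hτ ℓ (descentOp hτ w (m w) x) k (Function.update m w (m w - 2)) := by
  obtain ⟨hR, hC⟩ := commute_descentOp_letters hτ w (m w : ℂ)
  have hm0 : (m w : ℂ) ≠ 0 := by exact_mod_cast (show m w ≠ 0 by omega)
  have hm1 : (m w : ℂ) - 1 ≠ 0 := by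
    have : ((m w - 1 : ℕ) : ℂ) ≠ 0 := by exact_mod_cast (show m w - 1 ≠ 0 by omega)
    rwa [Nat.cast_sub (by omega), Nat.cast_one] at this
  obtain ⟨hE', hT'⟩ := descentOp_highest hτ w (m w : ℂ) hm0 hm1 x (h.raising w) (h.torusC w)
  refine h.map_complex hτ w ?_ hS hR hC ?_ hE'
  · -- `K_∞`-finiteness: the descent is a polynomial in the letters
    have hD : ∀ (X : Matrix (Fin 2) (Fin 2) (mixedSpace K)) (v : archGardingSpace hcpt τ), v ∈ archKFinite hτ →
        D X v ∈ archKFinite hτ := fun X v hv => gardingEnd_mem_archKFinite hτ X hv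
    have hh : ∀ (i j : Fin 2) (v : archGardingSpace hcpt τ), v ∈ archKFinite hτ →
        (D (Matrix.single i j ((0, Pi.single w 1) : mixedSpace K)) -
          Complex.I • D (Matrix.single i j ((0, Pi.single w Complex.I) : mixedSpace K))) v ∈ archKFinite hτ :=
      fun i j v hv => by
        rw [LinearMap.sub_apply, LinearMap.smul_apply]
        exact Submodule.sub_mem _ (hD _ v hv) (Submodule.smul_mem _ _ (hD _ v hv))
    have ha : ∀ (i j : Fin 2) (v : archGardingSpace hcpt τ), v ∈ archKFinite hτ →
        (D (Matrix.single i j ((0, Pi.single w 1) : mixedSpace K)) +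
          Complex.I • D (Matrix.single i j ((0, Pi.single w Complex.I) : mixedSpace K))) v ∈ archKFinite hτ :=
      fun i j v hv => by
        rw [LinearMap.add_apply, LinearMap.smul_apply]
        exact Submodule.add_mem _ (hD _ v hv) (Submodule.smul_mem _ _ (hD _ v hv))
    have hF : ∀ v : archGardingSpace hcpt τ, v ∈ archKFinite hτ → (Flo[w]) v ∈ archKFinite hτ := fun v hv => by
      rw [LinearMap.sub_apply]; exact Submodule.sub_mem _ (hh 1 0 v hv) (ha 0 1 v hv)
    rw [descentOp_apply]
    refine Submodule.sub_mem _ (Submodule.sub_mem _ ?_ (Submodule.smul_mem _ _ ?_)) (Submodule.smul_mem _ _ ?_)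
    · rw [LinearMap.add_apply]; exact Submodule.add_mem _ (hh 1 0 x h.kFinite) (ha 0 1 x h.kFinite)
    · rw [LinearMap.add_apply, LinearMap.smul_apply, LinearMap.smul_apply, LinearMap.sub_apply, LinearMap.sub_apply]
      have hv := hF x h.kFinite
      exact Submodule.add_mem _ (Submodule.smul_mem _ _ (Submodule.sub_mem _ (hh 0 0 _ hv) (hh 1 1 _ hv)))
        (Submodule.smul_mem _ _ (Submodule.sub_mem _ (ha 0 0 _ hv) (ha 1 1 _ hv)))
    · rw [LinearMap.add_apply]
      have hv := hF _ (hF x h.kFinite)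
      exact Submodule.add_mem _ (hh 0 1 _ hv) (ha 1 0 _ hv)
  · rw [hT', Nat.cast_sub h2]
    push_cast
    ring_nf


/-! ### Scalars: the Casimir form `R_w L_w` on weight-`±1` vectors -/

include hτu hτi in
/-- On vectors of weight `i` (resp. `-i`) under `τ(W_w)`, `R_w L_w` (resp. `L_w R_w`) acts by one and the same
scalar `2λ_w - μ_w² + 1` (`λ_w`, `μ_w` the Casimir and central scalars of the place `w` on `𝒢`).
[cite: JacquetLanglands1970, §5 (Lemma 5.6)] -/
theorem exists_raising_lowering_eq_smul (w : {w : InfinitePlace K // IsReal w}) :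
    ∃ c : ℂ, (∀ v : archGardingSpace hcpt τ, D W[w] v = Complex.I • v → Ra[w] (Lo[w] v) = c • v) ∧
      ∀ v : archGardingSpace hcpt τ, D W[w] v = (-Complex.I) • v → Lo[w] (Ra[w] v) = c • v := by
  obtain ⟨μ, hμ⟩ := exists_gardingEnd_smul_one_eq_smul hτ hτu hτi ((Pi.single w 1, 0) : mixedSpace K)
  obtain ⟨lam, hlam⟩ := exists_placeCasimirReal_gardingEnd_eq_smul hτ hτu hτi w
  have hZ : ∀ v : archGardingSpace hcpt τ, D H₀[w] v + D H₁[w] v = μ • v := fun v => by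
    rw [← LinearMap.add_apply, ← gardingEnd_add, ← smul_one_eq_single_add_single, hμ]
  refine ⟨2 * lam - μ ^ 2 - 1 ^ 2 + 2 * 1, fun v hv => ?_, fun v hv => ?_⟩
  · exact raising_lowering_apply hτ w 1 μ lam v (by rw [mul_one]; exact hv) (hZ v) (hlam v)
  · have h := lowering_raising_apply hτ w (-1) μ lam v (by rw [mul_neg_one]; exact hv) (hZ v) (hlam v)
    rw [h]; ring_nf

include hτu hτi hℓW in
/-- `S_ℓ` is stable under `L_w` and `R_w`. [folklore] -/
theorem lowering_raising_mem_kirillovNull (w : {w : InfinitePlace K // IsReal w}) {v : archGardingSpace hcpt τ}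
    (hv : v ∈ kirillovNull hτ ℓ) : Lo[w] v ∈ kirillovNull hτ ℓ ∧ Ra[w] v ∈ kirillovNull hτ ℓ := by
  have h1 := gardingEnd_mem_kirillovNull_of_isUnitary hτ hτu hτi hℓW (H₀[w] - H₁[w]) hv
  have h2 := gardingEnd_mem_kirillovNull_of_isUnitary hτ hτu hτi hℓW (X⁺[w] + X⁻[w]) hv
  rw [LinearMap.sub_apply, LinearMap.add_apply, LinearMap.smul_apply]
  exact ⟨Submodule.sub_mem _ h1 (Submodule.smul_mem _ _ h2), Submodule.add_mem _ h1 (Submodule.smul_mem _ _ h2)⟩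

/-! ### The bad sets and the measure -/

variable (ℓ) in
/-- The real places of weight `±1` at which `x` is "bad": `R_w L_w x = 0` but `L_w x ∉ S_ℓ` (weight `1`), resp.
`L_w R_w x = 0` but `R_w x ∉ S_ℓ` (weight `-1`). [folklore] -/
def badOne (x : archGardingSpace hcpt τ) (k : {w : InfinitePlace K // IsReal w} → ℤ) : Finset {w : InfinitePlace K // IsReal w} :=
  Finset.univ.filter fun w =>
    (k w = 1 ∧ Ra[w] (Lo[w] x) = 0 ∧ Lo[w] x ∉ kirillovNull hτ ℓ) ∨ (k w = -1 ∧ Lo[w] (Ra[w] x) = 0 ∧ Ra[w] x ∉ kirillovNull hτ ℓ)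

/-- The real places of weight `0` at which `x` is not a `τ(δ_w)`-eigenvector. [folklore] -/
def badZero (δf : {w : InfinitePlace K // IsReal w} → GL (Fin 2) (mixedSpace K)) (x : archGardingSpace hcpt τ)
    (k : {w : InfinitePlace K // IsReal w} → ℤ) : Finset {w : InfinitePlace K // IsReal w} :=
  Finset.univ.filter fun w => k w = 0 ∧ gardingAct hτ (δf w) x ≠ x ∧ gardingAct hτ (δf w) x ≠ -x

variable (ℓ) in
/-- The measure minimised over the base candidates: `(2r₁+1)(Σ|k_w| + Σ m_w) + #badOne + #badZero`. [folklore] -/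
def candMeasure (δf : {w : InfinitePlace K // IsReal w} → GL (Fin 2) (mixedSpace K)) (x : archGardingSpace hcpt τ)
    (k : {w : InfinitePlace K // IsReal w} → ℤ) (m : {w : InfinitePlace K // IsComplex w} → ℕ) : ℕ :=
  (2 * Fintype.card {w : InfinitePlace K // IsReal w} + 1) * ((∑ w, (k w).natAbs) + ∑ w, m w) +
    (badOne hτ ℓ x k).card + (badZero hτ δf x k).card

omit hτ in
/-- Sum of `|k_w|` after updating one weight. [folklore] -/
theorem sum_natAbs_update (k : {w : InfinitePlace K // IsReal w} → ℤ) (w : {w : InfinitePlace K // IsReal w}) (a : ℤ) :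
    (∑ w', (Function.update k w a w').natAbs) + (k w).natAbs = (∑ w', (k w').natAbs) + a.natAbs := by
  rw [← Finset.add_sum_erase _ _ (Finset.mem_univ w), ← Finset.add_sum_erase _ (fun w' => (k w').natAbs) (Finset.mem_univ w),
    Function.update_self]
  have h : ∑ x ∈ Finset.univ.erase w, (Function.update k w a x).natAbs = ∑ x ∈ Finset.univ.erase w, (k x).natAbs :=
    Finset.sum_congr rfl fun x hx => by rw [Function.update_of_ne (Finset.ne_of_mem_erase hx)]
  rw [h]; ring

omit hτ in
/-- Sum of `m_w` after updating one weight. [folklore] -/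
theorem sum_update_nat (m : {w : InfinitePlace K // IsComplex w} → ℕ) (w : {w : InfinitePlace K // IsComplex w}) (a : ℕ) :
    (∑ w', Function.update m w a w') + m w = (∑ w', m w') + a := by
  rw [← Finset.add_sum_erase _ _ (Finset.mem_univ w), ← Finset.add_sum_erase _ m (Finset.mem_univ w), Function.update_self]
  have h : ∑ x ∈ Finset.univ.erase w, Function.update m w a x = ∑ x ∈ Finset.univ.erase w, m x :=
    Finset.sum_congr rfl fun x hx => by rw [Function.update_of_ne (Finset.ne_of_mem_erase hx)]
  rw [h]; ring

/-- The measure strictly decreases when `Σ|k_w| + Σ m_w` does. [folklore] -/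
theorem candMeasure_lt_of_lt (δf : {w : InfinitePlace K // IsReal w} → GL (Fin 2) (mixedSpace K))
    {x x' : archGardingSpace hcpt τ} {k k' : {w : InfinitePlace K // IsReal w} → ℤ} {m m' : {w : InfinitePlace K // IsComplex w} → ℕ}
    (h : (∑ w, (k' w).natAbs) + ∑ w, m' w < (∑ w, (k w).natAbs) + ∑ w, m w) :
    candMeasure hτ ℓ δf x' k' m' < candMeasure hτ ℓ δf x k m := by
  unfold candMeasure
  have h1 : (badOne hτ ℓ x' k').card ≤ Fintype.card {w : InfinitePlace K // IsReal w} := Finset.card_le_univ _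
  have h2 : (badZero hτ δf x' k').card ≤ Fintype.card {w : InfinitePlace K // IsReal w} := Finset.card_le_univ _
  nlinarith [h1, h2, Nat.zero_le (badOne hτ ℓ x k).card, Nat.zero_le (badZero hτ δf x k).card]

/-! ### Minimal candidates and their properties -/

variable {δf : {w : InfinitePlace K // IsReal w} → GL (Fin 2) (mixedSpace K)}
  (hδf : ∀ w, (δf w : Matrix (Fin 2) (Fin 2) (mixedSpace K)) = 1 - (2 : ℝ) • Matrix.single (0 : Fin 2) (0 : Fin 2) ((Pi.single w 1, 0) : mixedSpace K))

/-- **Minimal candidates: weights `≥ 2` are lowest modulo `S_ℓ`** (`L_w x ∈ S_ℓ`). [cite: JacquetLanglands1970, §5] -/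
theorem IsBaseCandidate.lowering_mem_of_minimal {x : archGardingSpace hcpt τ} {k : {w : InfinitePlace K // IsReal w} → ℤ}
    {m : {w : InfinitePlace K // IsComplex w} → ℕ} (h : IsBaseCandidate hτ ℓ x k m)
    (hmin : ∀ x' k' m', IsBaseCandidate hτ ℓ x' k' m' → candMeasure hτ ℓ δf x k m ≤ candMeasure hτ ℓ δf x' k' m')
    (w : {w : InfinitePlace K // IsReal w}) (hk : 2 ≤ k w) : Lo[w] x ∈ kirillovNull hτ ℓ := by
  by_contra hS
  have h' := h.lowering hτ w hS
  refine absurd (hmin _ _ _ h') (not_le.2 (candMeasure_lt_of_lt hτ δf ?_))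
  have hs := sum_natAbs_update k w (k w - 2)
  have : (k w - 2).natAbs + 2 = (k w).natAbs := by omega
  omega

/-- **Minimal candidates: weights `≤ -2` are highest modulo `S_ℓ`** (`R_w x ∈ S_ℓ`). [cite: JacquetLanglands1970, §5] -/
theorem IsBaseCandidate.raising_mem_of_minimal {x : archGardingSpace hcpt τ} {k : {w : InfinitePlace K // IsReal w} → ℤ}
    {m : {w : InfinitePlace K // IsComplex w} → ℕ} (h : IsBaseCandidate hτ ℓ x k m)
    (hmin : ∀ x' k' m', IsBaseCandidate hτ ℓ x' k' m' → candMeasure hτ ℓ δf x k m ≤ candMeasure hτ ℓ δf x' k' m')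
    (w : {w : InfinitePlace K // IsReal w}) (hk : k w ≤ -2) : Ra[w] x ∈ kirillovNull hτ ℓ := by
  by_contra hS
  have h' := h.raising' hτ w hS
  refine absurd (hmin _ _ _ h') (not_le.2 (candMeasure_lt_of_lt hτ δf ?_))
  have hs := sum_natAbs_update k w (k w + 2)
  have : (k w + 2).natAbs + 2 = (k w).natAbs := by omega
  omega

/-- **Minimal candidates: the `K`-type descents lie in `S_ℓ`**. [cite: JacquetLanglands1970, §6] -/
theorem IsBaseCandidate.descentOp_mem_of_minimal {x : archGardingSpace hcpt τ} {k : {w : InfinitePlace K // IsReal w} → ℤ}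
    {m : {w : InfinitePlace K // IsComplex w} → ℕ} (h : IsBaseCandidate hτ ℓ x k m)
    (hmin : ∀ x' k' m', IsBaseCandidate hτ ℓ x' k' m' → candMeasure hτ ℓ δf x k m ≤ candMeasure hτ ℓ δf x' k' m')
    (w : {w : InfinitePlace K // IsComplex w}) (h2 : 2 ≤ m w) : descentOp hτ w (m w) x ∈ kirillovNull hτ ℓ := by
  by_contra hS
  have h' := h.descent hτ w h2 hS
  refine absurd (hmin _ _ _ h') (not_le.2 (candMeasure_lt_of_lt hτ δf ?_))
  have hs := sum_update_nat m w (m w - 2)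
  omega

include hτu hτi in
/-- Badness at the OTHER real places does not increase under an endomorphism `Φ` commuting with their letters
and signs and preserving `S_ℓ`, with `Φ x ≠ 0`. [folklore] -/
theorem badOne_subset_of_commute {x : archGardingSpace hcpt τ} {k k' : {w : InfinitePlace K // IsReal w} → ℤ}
    (w : {w : InfinitePlace K // IsReal w}) {Φ : Module.End ℂ (archGardingSpace hcpt τ)} (hΦ0 : Φ x ≠ 0)
    (hΦS : ∀ v ∈ kirillovNull hτ ℓ, Φ v ∈ kirillovNull hτ ℓ)
    (hR : ∀ w', w' ≠ w → ∀ i j : Fin 2, Commute Φ (D (Matrix.single i j ((Pi.single w' 1, 0) : mixedSpace K))))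
    (hk' : ∀ w', w' ≠ w → k' w' = k w') (hw : w ∉ badOne hτ ℓ (Φ x) k')
    (hxW : ∀ w', D W[w'] x = (Complex.I * k w') • x) :
    badOne hτ ℓ (Φ x) k' ⊆ badOne hτ ℓ x k := by
  intro w' hw'
  have hne : w' ≠ w := by rintro rfl; exact hw hw'
  obtain ⟨hcW, hcL, hcR⟩ := commute_weylR_lowering_raising hτ w' (hR w' hne)
  obtain ⟨c, hc1, hc2⟩ := exists_raising_lowering_eq_smul hτ hτu hτi w'
  simp only [badOne, Finset.mem_filter, Finset.mem_univ, true_and] at hw' ⊢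
  rw [hk' w' hne] at hw'
  have eL : Lo[w'] (Φ x) = Φ (Lo[w'] x) := by rw [← Module.End.mul_apply, ← hcL.eq, Module.End.mul_apply]
  have eR : Ra[w'] (Φ x) = Φ (Ra[w'] x) := by rw [← Module.End.mul_apply, ← hcR.eq, Module.End.mul_apply]
  rcases hw' with ⟨hk1, h0, hS⟩ | ⟨hk1, h0, hS⟩
  · refine Or.inl ⟨hk1, ?_, fun hmem => hS ?_⟩
    · have hxw : D W[w'] x = Complex.I • x := by rw [hxW w', hk1]; simp
      have hΦw : D W[w'] (Φ x) = Complex.I • Φ x := by rw [← Module.End.mul_apply, ← hcW.eq, Module.End.mul_apply, hxw, map_smul]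
      have h1 := hc1 x hxw
      have h2 := hc1 (Φ x) hΦw
      rw [h0] at h2
      have hc0 : c = 0 := by
        by_contra hc
        exact hΦ0 (by simpa [hc] using (smul_eq_zero.1 h2.symm))
      rw [h1, hc0, zero_smul]
    · rw [eL]; exact hΦS _ hmem
  · refine Or.inr ⟨hk1, ?_, fun hmem => hS ?_⟩
    · have hxw : D W[w'] x = (-Complex.I) • x := by rw [hxW w', hk1]; simp
      have hΦw : D W[w'] (Φ x) = (-Complex.I) • Φ x := by rw [← Module.End.mul_apply, ← hcW.eq, Module.End.mul_apply, hxw, map_smul]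
      have h1 := hc2 x hxw
      have h2 := hc2 (Φ x) hΦw
      rw [h0] at h2
      have hc0 : c = 0 := by
        by_contra hc
        exact hΦ0 (by simpa [hc] using (smul_eq_zero.1 h2.symm))
      rw [h1, hc0, zero_smul]
    · rw [eR]; exact hΦS _ hmem

/-- Likewise for `badZero`: `τ(δ_{w'})`-eigenvectors stay eigenvectors under `Φ` commuting with `τ(δ_{w'})`.
[folklore] -/
theorem badZero_subset_of_commute {x : archGardingSpace hcpt τ} {k k' : {w : InfinitePlace K // IsReal w} → ℤ}
    (w : {w : InfinitePlace K // IsReal w}) {Φ : Module.End ℂ (archGardingSpace hcpt τ)}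
    (hδ : ∀ w', w' ≠ w → Commute Φ (gardingAct hτ (δf w')))
    (hk' : ∀ w', w' ≠ w → k' w' = k w') (hw : w ∉ badZero hτ δf (Φ x) k') :
    badZero hτ δf (Φ x) k' ⊆ badZero hτ δf x k := by
  intro w' hw'
  have hne : w' ≠ w := by rintro rfl; exact hw hw'
  simp only [badZero, Finset.mem_filter, Finset.mem_univ, true_and] at hw' ⊢
  rw [hk' w' hne] at hw'
  obtain ⟨hk0, h1, h2⟩ := hw'
  have e : gardingAct hτ (δf w') (Φ x) = Φ (gardingAct hτ (δf w') x) := by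
    rw [← Module.End.mul_apply, ← (hδ w' hne).eq, Module.End.mul_apply]
  refine ⟨hk0, fun h => h1 ?_, fun h => h2 ?_⟩
  · rw [e, h]
  · rw [e, h, map_neg]

include hδf in
/-- `τ(δ_w)` and `τ(δ_{w'})` commute. [folklore] -/
theorem commute_gardingAct_realSign (w w' : {w : InfinitePlace K // IsReal w}) :
    Commute (gardingAct hτ (δf w)) (gardingAct hτ (δf w')) := by
  change gardingAct hτ (δf w) * gardingAct hτ (δf w') = gardingAct hτ (δf w') * gardingAct hτ (δf w)
  rw [← gardingAct_mul, ← gardingAct_mul, realSign_eq_diagGL2 (hδf w), realSign_eq_diagGL2 (hδf w'), diagGL2_one_comm]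

include hτu hτi hℓW hδf in
/-- **Minimal candidates have no bad weight-`±1` places.** [cite: JacquetLanglands1970, §5] -/
theorem IsBaseCandidate.badOne_eq_empty_of_minimal {x : archGardingSpace hcpt τ} {k : {w : InfinitePlace K // IsReal w} → ℤ}
    {m : {w : InfinitePlace K // IsComplex w} → ℕ} (h : IsBaseCandidate hτ ℓ x k m)
    (hmin : ∀ x' k' m', IsBaseCandidate hτ ℓ x' k' m' → candMeasure hτ ℓ δf x k m ≤ candMeasure hτ ℓ δf x' k' m') :
    badOne hτ ℓ x k = ∅ := by
  by_contra hne
  obtain ⟨w, hw⟩ := Finset.nonempty_iff_ne_empty.2 hne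
  have hw0 := hw
  simp only [badOne, Finset.mem_filter, Finset.mem_univ, true_and] at hw
  obtain ⟨hRl, hCl⟩ := commute_lowering_raising_letters hτ w
  rcases hw with ⟨hk1, h0, hS⟩ | ⟨hk1, h0, hS⟩
  · -- replace `x` by `L_w x`
    have h' := h.lowering hτ w hS
    have hsum : (∑ w', (Function.update k w (k w - 2) w').natAbs) = ∑ w', (k w').natAbs := by
      have hs := sum_natAbs_update k w (k w - 2); omega
    have hw' : w ∉ badOne hτ ℓ (Lo[w] x) (Function.update k w (k w - 2)) := by
      intro hmem
      simp only [badOne, Finset.mem_filter, Finset.mem_univ, true_and, Function.update_self] at hmem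
      rcases hmem with ⟨h1, -, -⟩ | ⟨-, -, h3⟩
      · omega
      · exact h3 (by rw [h0]; exact Submodule.zero_mem _)
    have hsub₁ := badOne_subset_of_commute hτ hτu hτi w h'.ne_zero
      (fun v hv => (lowering_raising_mem_kirillovNull hτ hτu hτi hℓW w hv).1) (fun w' hw' i j => (hRl w' hw' i j).1)
      (fun w' hw' => Function.update_of_ne hw' _ _) hw' h.weylR
    have hsub₀ := badZero_subset_of_commute hτ (δf := δf) w (k := k) (k' := Function.update k w (k w - 2))
      (Φ := Lo[w]) (x := x)
      (fun w' hw' => ((commute_weylR_lowering_raising hτ w ((commute_gardingAct_realSign_letters hτ (hδf w')).1 w (Ne.symm hw'))).2.1).symm)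
      (fun w' hw' => Function.update_of_ne hw' _ _)
      (by
        intro hmem
        simp only [badZero, Finset.mem_filter, Finset.mem_univ, true_and, Function.update_self] at hmem
        omega)
    have hc₁ : (badOne hτ ℓ (Lo[w] x) (Function.update k w (k w - 2))).card < (badOne hτ ℓ x k).card :=
      Finset.card_lt_card (Finset.ssubset_iff_subset_ne.2 ⟨hsub₁, fun he => hw' (he ▸ hw0)⟩)
    have hc₀ := Finset.card_le_card hsub₀
    have hlt : candMeasure hτ ℓ δf (Lo[w] x) (Function.update k w (k w - 2)) m < candMeasure hτ ℓ δf x k m := by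
      unfold candMeasure; rw [hsum]; omega
    exact absurd (hmin _ _ _ h') (not_le.2 hlt)
  · -- replace `x` by `R_w x`
    have h' := h.raising' hτ w hS
    have hsum : (∑ w', (Function.update k w (k w + 2) w').natAbs) = ∑ w', (k w').natAbs := by
      have hs := sum_natAbs_update k w (k w + 2); omega
    have hw' : w ∉ badOne hτ ℓ (Ra[w] x) (Function.update k w (k w + 2)) := by
      intro hmem
      simp only [badOne, Finset.mem_filter, Finset.mem_univ, true_and, Function.update_self] at hmem
      rcases hmem with ⟨-, -, h3⟩ | ⟨h1, -, -⟩
      · exact h3 (by rw [h0]; exact Submodule.zero_mem _)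
      · omega
    have hsub₁ := badOne_subset_of_commute hτ hτu hτi w h'.ne_zero
      (fun v hv => (lowering_raising_mem_kirillovNull hτ hτu hτi hℓW w hv).2) (fun w' hw' i j => (hRl w' hw' i j).2)
      (fun w' hw' => Function.update_of_ne hw' _ _) hw' h.weylR
    have hsub₀ := badZero_subset_of_commute hτ (δf := δf) w (k := k) (k' := Function.update k w (k w + 2))
      (Φ := Ra[w]) (x := x)
      (fun w' hw' => ((commute_weylR_lowering_raising hτ w ((commute_gardingAct_realSign_letters hτ (hδf w')).1 w (Ne.symm hw'))).2.2).symm)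
      (fun w' hw' => Function.update_of_ne hw' _ _)
      (by
        intro hmem
        simp only [badZero, Finset.mem_filter, Finset.mem_univ, true_and, Function.update_self] at hmem
        omega)
    have hc₁ : (badOne hτ ℓ (Ra[w] x) (Function.update k w (k w + 2))).card < (badOne hτ ℓ x k).card :=
      Finset.card_lt_card (Finset.ssubset_iff_subset_ne.2 ⟨hsub₁, fun he => hw' (he ▸ hw0)⟩)
    have hc₀ := Finset.card_le_card hsub₀
    have hlt : candMeasure hτ ℓ δf (Ra[w] x) (Function.update k w (k w + 2)) m < candMeasure hτ ℓ δf x k m := by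
      unfold candMeasure; rw [hsum]; omega
    exact absurd (hmin _ _ _ h') (not_le.2 hlt)

include hτu hτi hδf in
/-- **Minimal candidates are `τ(δ_w)`-eigenvectors at their weight-`0` places.** [folklore] -/
theorem IsBaseCandidate.badZero_eq_empty_of_minimal {x : archGardingSpace hcpt τ} {k : {w : InfinitePlace K // IsReal w} → ℤ}
    {m : {w : InfinitePlace K // IsComplex w} → ℕ} (h : IsBaseCandidate hτ ℓ x k m)
    (hmin : ∀ x' k' m', IsBaseCandidate hτ ℓ x' k' m' → candMeasure hτ ℓ δf x k m ≤ candMeasure hτ ℓ δf x' k' m') :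
    badZero hτ δf x k = ∅ := by
  by_contra hne
  obtain ⟨w, hw⟩ := Finset.nonempty_iff_ne_empty.2 hne
  have hw0 := hw
  simp only [badZero, Finset.mem_filter, Finset.mem_univ, true_and] at hw
  obtain ⟨hk0, -, -⟩ := hw
  -- one of `x ± τ(δ_w) x` is outside `S_ℓ`
  obtain ⟨ε, hε, hS⟩ : ∃ ε : ℂ, (ε = 1 ∨ ε = -1) ∧ x + ε • gardingAct hτ (δf w) x ∉ kirillovNull hτ ℓ := by
    by_contra hall
    push Not at hall
    have h1 := hall 1 (Or.inl rfl)
    have h2 := hall (-1) (Or.inr rfl)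
    apply h.not_mem
    have h12 := Submodule.add_mem _ h1 h2
    rw [one_smul, neg_one_smul, add_add_add_comm, add_neg_cancel, add_zero, ← two_smul ℂ] at h12
    have h3 := Submodule.smul_mem _ (2⁻¹ : ℂ) h12
    rwa [smul_smul, inv_mul_cancel₀ (two_ne_zero' ℂ), one_smul] at h3
  have h' := h.realSign_symm hτ w (hδf w) hk0 ε hS
  have hε2 : ε * ε = 1 := by rcases hε with rfl | rfl <;> norm_num
  obtain ⟨hRδ, hCδ⟩ := commute_gardingAct_realSign_letters hτ (hδf w)
  set Φ : Module.End ℂ (archGardingSpace hcpt τ) := 1 + ε • gardingAct hτ (δf w) with hΦdef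
  have hΦ : Φ x = x + ε • gardingAct hτ (δf w) x := by
    rw [hΦdef, LinearMap.add_apply, Module.End.one_apply, LinearMap.smul_apply]
  -- `τ(δ_w) x' = ε x'`
  have hδx' : gardingAct hτ (δf w) (x + ε • gardingAct hτ (δf w) x) = ε • (x + ε • gardingAct hτ (δf w) x) := by
    rw [map_add, map_smul, ← Module.End.mul_apply, gardingAct_realSign_mul_self hτ (hδf w), Module.End.one_apply, smul_add,
      smul_smul, hε2, one_smul, add_comm]
  have hw' : w ∉ badZero hτ δf (Φ x) k := by
    intro hmem
    simp only [badZero, Finset.mem_filter, Finset.mem_univ, true_and, hΦ, hδx'] at hmem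
    obtain ⟨-, h1, h2⟩ := hmem
    rcases hε with rfl | rfl
    · exact h1 (one_smul _ _)
    · exact h2 (neg_one_smul _ _)
  have hsub₀ := badZero_subset_of_commute hτ (δf := δf) w (k := k) (k' := k) (Φ := Φ) (x := x)
    (fun w' _ => (Commute.one_left _).add_left (((commute_gardingAct_realSign hτ hδf w' w).symm).smul_left ε))
    (fun _ _ => rfl) hw'
  have hΦ0 : Φ x ≠ 0 := by rw [hΦ]; exact h'.ne_zero
  have hΦS : ∀ v ∈ kirillovNull hτ ℓ, Φ v ∈ kirillovNull hτ ℓ := fun v hv => by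
    rw [hΦdef, LinearMap.add_apply, Module.End.one_apply, LinearMap.smul_apply]
    exact Submodule.add_mem _ hv (Submodule.smul_mem _ _ ((gardingAct_realSign_mem_kirillovNull_iff hτ (hδf w) ℓ v).2 hv))
  have hwb : w ∉ badOne hτ ℓ (Φ x) k := by
    intro hmem
    simp only [badOne, Finset.mem_filter, Finset.mem_univ, true_and] at hmem
    rcases hmem with ⟨h1, -, -⟩ | ⟨h1, -, -⟩ <;> omega
  have hsub₁ := badOne_subset_of_commute hτ hτu hτi w hΦ0 hΦS
    (fun w' hw' i j => (Commute.one_left _).add_left ((hRδ w' hw' i j).smul_left ε)) (fun _ _ => rfl) hwb h.weylR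
  have hc₀ : (badZero hτ δf (Φ x) k).card < (badZero hτ δf x k).card :=
    Finset.card_lt_card (Finset.ssubset_iff_subset_ne.2 ⟨hsub₀, fun he => hw' (he ▸ hw0)⟩)
  have hc₁ := Finset.card_le_card hsub₁
  have hlt : candMeasure hτ ℓ δf (Φ x) k m < candMeasure hτ ℓ δf x k m := by
    unfold candMeasure; omega
  rw [hΦ] at hlt
  exact absurd (hmin _ _ _ h') (not_le.2 hlt)

/-! ### The sign flip -/

include hδf in
/-- **The side conditions of a minimal candidate are stable under the signs `τ(δ_w)`**, in the form needed to
make all real weights non-negative. [folklore] -/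
theorem IsBaseCandidate.flip_step {x : archGardingSpace hcpt τ} {k : {w : InfinitePlace K // IsReal w} → ℤ}
    {m : {w : InfinitePlace K // IsComplex w} → ℕ} (h : IsBaseCandidate hτ ℓ x k m)
    (hL : ∀ w, 2 ≤ k w → Lo[w] x ∈ kirillovNull hτ ℓ) (hRa : ∀ w, k w ≤ -2 → Ra[w] x ∈ kirillovNull hτ ℓ)
    (hD : ∀ w, 2 ≤ m w → descentOp hτ w (m w) x ∈ kirillovNull hτ ℓ)
    (hb₁ : badOne hτ ℓ x k = ∅) (hb₀ : badZero hτ δf x k = ∅) (w₀ : {w : InfinitePlace K // IsReal w}) :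
    let x' := gardingAct hτ (δf w₀) x
    let k' := Function.update k w₀ (-k w₀)
    IsBaseCandidate hτ ℓ x' k' m ∧
    (∀ w, 2 ≤ k' w → Lo[w] x' ∈ kirillovNull hτ ℓ) ∧ (∀ w, k' w ≤ -2 → Ra[w] x' ∈ kirillovNull hτ ℓ) ∧
    (∀ w, 2 ≤ m w → descentOp hτ w (m w) x' ∈ kirillovNull hτ ℓ) ∧
    badOne hτ ℓ x' k' = ∅ ∧ badZero hτ δf x' k' = ∅ := by
  intro x' k'
  have h' : IsBaseCandidate hτ ℓ x' k' m := h.realSign hτ w₀ (hδf w₀)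
  obtain ⟨hRδ, hCδ⟩ := commute_gardingAct_realSign_letters hτ (hδf w₀)
  obtain ⟨hδL, hδR⟩ := gardingAct_realSign_mul_lowering_raising hτ w₀ (hδf w₀)
  have hSδ : ∀ v, gardingAct hτ (δf w₀) v ∈ kirillovNull hτ ℓ ↔ v ∈ kirillovNull hτ ℓ :=
    gardingAct_realSign_mem_kirillovNull_iff hτ (hδf w₀) ℓ
  -- at `w₀`: `L (δ x) = δ (R x)`, `R (δ x) = δ (L x)`
  have eL₀ : Lo[w₀] x' = gardingAct hτ (δf w₀) (Ra[w₀] x) := by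
    change Lo[w₀] (gardingAct hτ (δf w₀) x) = _
    rw [← Module.End.mul_apply, ← hδR, Module.End.mul_apply]
  have eR₀ : Ra[w₀] x' = gardingAct hτ (δf w₀) (Lo[w₀] x) := by
    change Ra[w₀] (gardingAct hτ (δf w₀) x) = _
    rw [← Module.End.mul_apply, ← hδL, Module.End.mul_apply]
  -- at `w ≠ w₀`: everything commutes with `τ(δ_{w₀})`
  have eL : ∀ w, w ≠ w₀ → Lo[w] x' = gardingAct hτ (δf w₀) (Lo[w] x) ∧ Ra[w] x' = gardingAct hτ (δf w₀) (Ra[w] x) := by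
    intro w hw
    obtain ⟨-, hcL, hcR⟩ := commute_weylR_lowering_raising hτ w (hRδ w hw)
    exact ⟨by change Lo[w] (gardingAct hτ (δf w₀) x) = _; rw [← Module.End.mul_apply, ← hcL.eq, Module.End.mul_apply],
      by change Ra[w] (gardingAct hτ (δf w₀) x) = _; rw [← Module.End.mul_apply, ← hcR.eq, Module.End.mul_apply]⟩
  refine ⟨h', fun w hw => ?_, fun w hw => ?_, fun w hw => ?_, ?_, ?_⟩
  · by_cases hww : w = w₀
    · subst hww
      simp only [k', Function.update_self] at hw
      rw [eL₀, hSδ]; exact hRa w (by omega)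
    · simp only [k', Function.update_of_ne hww] at hw
      rw [(eL w hww).1, hSδ]; exact hL w hw
  · by_cases hww : w = w₀
    · subst hww
      simp only [k', Function.update_self] at hw
      rw [eR₀, hSδ]; exact hL w (by omega)
    · simp only [k', Function.update_of_ne hww] at hw
      rw [(eL w hww).2, hSδ]; exact hRa w hw
  · have hc := commute_descentOp hτ w (Φ := gardingAct hτ (δf w₀)) (fun i j => hCδ w 1 i j) (fun i j => hCδ w Complex.I i j) (m w)
    change descentOp hτ w (m w) (gardingAct hτ (δf w₀) x) ∈ _
    rw [← Module.End.mul_apply, ← hc.eq, Module.End.mul_apply, hSδ]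
    exact hD w hw
  · -- no bad weight-`±1` places
    refine Finset.eq_empty_iff_forall_notMem.2 fun w hw => ?_
    have hxb : w ∉ badOne hτ ℓ x k := by rw [hb₁]; exact Finset.notMem_empty _
    simp only [badOne, Finset.mem_filter, Finset.mem_univ, true_and] at hw hxb
    apply hxb
    by_cases hww : w = w₀
    · subst hww
      simp only [k', Function.update_self] at hw
      rw [eL₀, eR₀, hSδ, hSδ] at hw
      rcases hw with ⟨hk1, h0, hS⟩ | ⟨hk1, h0, hS⟩
      · refine Or.inr ⟨by omega, ?_, hS⟩
        rw [← Module.End.mul_apply, ← hδL, Module.End.mul_apply] at h0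
        have h1 := congrArg (gardingAct hτ (δf w)) h0
        rwa [← Module.End.mul_apply, gardingAct_realSign_mul_self hτ (hδf w), Module.End.one_apply, map_zero] at h1
      · refine Or.inl ⟨by omega, ?_, hS⟩
        rw [← Module.End.mul_apply, ← hδR, Module.End.mul_apply] at h0
        have h1 := congrArg (gardingAct hτ (δf w)) h0
        rwa [← Module.End.mul_apply, gardingAct_realSign_mul_self hτ (hδf w), Module.End.one_apply, map_zero] at h1
    · simp only [k', Function.update_of_ne hww] at hw
      obtain ⟨e1, e2⟩ := eL w hww
      have hinj : ∀ v : archGardingSpace hcpt τ, gardingAct hτ (δf w₀) v = 0 → v = 0 := fun v hv => by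
        have h1 := congrArg (gardingAct hτ (δf w₀)) hv
        rwa [← Module.End.mul_apply, gardingAct_realSign_mul_self hτ (hδf w₀), Module.End.one_apply, map_zero] at h1
      rw [e1, e2, hSδ, hSδ] at hw
      rcases hw with ⟨hk1, h0, hS⟩ | ⟨hk1, h0, hS⟩
      · refine Or.inl ⟨hk1, hinj _ ?_, hS⟩
        obtain ⟨-, -, hcR⟩ := commute_weylR_lowering_raising hτ w (hRδ w hww)
        rwa [← Module.End.mul_apply, ← hcR.eq, Module.End.mul_apply] at h0
      · refine Or.inr ⟨hk1, hinj _ ?_, hS⟩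
        obtain ⟨-, hcL, -⟩ := commute_weylR_lowering_raising hτ w (hRδ w hww)
        rwa [← Module.End.mul_apply, ← hcL.eq, Module.End.mul_apply] at h0
  · -- weight-`0` places stay eigenvectors
    refine Finset.eq_empty_iff_forall_notMem.2 fun w hw => ?_
    have hxb : w ∉ badZero hτ δf x k := by rw [hb₀]; exact Finset.notMem_empty _
    simp only [badZero, Finset.mem_filter, Finset.mem_univ, true_and, not_and, not_not] at hw hxb
    obtain ⟨hk0, h1, h2⟩ := hw
    by_cases hww : w = w₀
    · subst hww
      simp only [k', Function.update_self, neg_eq_zero] at hk0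
      -- weight `0` at `w₀`: `τ(δ) x = ± x` gives `τ(δ) (τ(δ) x) = ± τ(δ) x`
      rcases eq_or_ne (gardingAct hτ (δf w) x) x with hx | hx
      · exact h1 (by change gardingAct hτ (δf w) (gardingAct hτ (δf w) x) = gardingAct hτ (δf w) x; rw [hx, hx])
      · have hx' := hxb hk0 hx
        exact h2 (by change gardingAct hτ (δf w) (gardingAct hτ (δf w) x) = -gardingAct hτ (δf w) x; rw [hx', map_neg, hx'])
    · simp only [k', Function.update_of_ne hww] at hk0
      have hc := commute_gardingAct_realSign hτ hδf w w₀
      have e : gardingAct hτ (δf w) x' = gardingAct hτ (δf w₀) (gardingAct hτ (δf w) x) := by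
        change gardingAct hτ (δf w) (gardingAct hτ (δf w₀) x) = _
        rw [← Module.End.mul_apply, hc.eq, Module.End.mul_apply]
      rcases eq_or_ne (gardingAct hτ (δf w) x) x with hx | hx
      · exact h1 (by rw [e, hx])
      · have hx' := hxb hk0 hx
        exact h2 (by rw [e, hx', map_neg])

/-! ### The normal form -/

include hτu hτi hℓW hδf in
/-- **Normal form of the base vector.** For an irreducible unitary `τ` and a non-zero continuous
`ψ_∞`-Whittaker functional `ℓ` there is a base candidate `x` (a `K_∞`-finite joint weight vector outside
`S_ℓ`, highest with exact strings at the complex places) such that: all real weights are `≥ 0`; at a real place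
of weight `0`, `τ(δ_w) x = ± x`; at a real place of weight `1`, `R_w L_w x ≠ 0` or `L_w x ∈ S_ℓ`; at a real place of
weight `≥ 2`, `L_w x ∈ S_ℓ`; at a complex place with `m_w ≥ 2` the `K`-type descent of `x` lies in `S_ℓ`.
(Jacquet–Langlands (1970), §5–§6: reduction to the lowest vectors of the minimal `K_∞`-type, here carried out
modulo the null space of the Kirillov map.) [cite: JacquetLanglands1970, §5 (Thm. 5.13), §6 (Thm. 6.2–6.4)] -/
theorem exists_isBaseCandidate_normalForm (hne : ℓ ≠ 0)
    (hex : ∃ (x : archGardingSpace hcpt τ) (k : {w : InfinitePlace K // IsReal w} → ℤ) (m : {w : InfinitePlace K // IsComplex w} → ℕ),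
      IsBaseCandidate hτ ℓ x k m) :
    ∃ (x : archGardingSpace hcpt τ) (k : {w : InfinitePlace K // IsReal w} → ℤ) (m : {w : InfinitePlace K // IsComplex w} → ℕ),
      IsBaseCandidate hτ ℓ x k m ∧ (∀ w, 0 ≤ k w) ∧
      (∀ w, k w = 0 → gardingAct hτ (δf w) x = x ∨ gardingAct hτ (δf w) x = -x) ∧
      (∀ w, k w = 1 → Ra[w] (Lo[w] x) ≠ 0 ∨ Lo[w] x ∈ kirillovNull hτ ℓ) ∧
      (∀ w, 2 ≤ k w → Lo[w] x ∈ kirillovNull hτ ℓ) ∧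
      (∀ w, 2 ≤ m w → descentOp hτ w (m w) x ∈ kirillovNull hτ ℓ) := by
  have _ := hne
  classical
  -- a minimal candidate
  let P : ℕ → Prop := fun n => ∃ (x : archGardingSpace hcpt τ) (k : {w : InfinitePlace K // IsReal w} → ℤ)
    (m : {w : InfinitePlace K // IsComplex w} → ℕ), IsBaseCandidate hτ ℓ x k m ∧ candMeasure hτ ℓ δf x k m = n
  have hP : ∃ n, P n := by obtain ⟨x, k, m, h⟩ := hex; exact ⟨_, x, k, m, h, rfl⟩
  obtain ⟨x₀, k₀, m₀, h₀, hn⟩ := Nat.find_spec hP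
  have hmin : ∀ x' k' m', IsBaseCandidate hτ ℓ x' k' m' → candMeasure hτ ℓ δf x₀ k₀ m₀ ≤ candMeasure hτ ℓ δf x' k' m' :=
    fun x' k' m' h' => by rw [hn]; exact Nat.find_min' hP ⟨x', k', m', h', rfl⟩
  have hL₀ := fun w => h₀.lowering_mem_of_minimal hτ (δf := δf) hmin w
  have hR₀ := fun w => h₀.raising_mem_of_minimal hτ (δf := δf) hmin w
  have hD₀ := fun w => h₀.descentOp_mem_of_minimal hτ (δf := δf) hmin w
  have hb₁ := h₀.badOne_eq_empty_of_minimal hτ hτu hτi hℓW hδf hmin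
  have hb₀ := h₀.badZero_eq_empty_of_minimal hτ hτu hτi hδf hmin
  -- flip the signs of the negative weights, one real place at a time
  have key : ∀ t : Finset {w : InfinitePlace K // IsReal w},
      ∃ (x : archGardingSpace hcpt τ) (k : {w : InfinitePlace K // IsReal w} → ℤ),
        IsBaseCandidate hτ ℓ x k m₀ ∧
        (∀ w, 2 ≤ k w → Lo[w] x ∈ kirillovNull hτ ℓ) ∧ (∀ w, k w ≤ -2 → Ra[w] x ∈ kirillovNull hτ ℓ) ∧
        (∀ w, 2 ≤ m₀ w → descentOp hτ w (m₀ w) x ∈ kirillovNull hτ ℓ) ∧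
        badOne hτ ℓ x k = ∅ ∧ badZero hτ δf x k = ∅ ∧ ∀ w ∈ t, 0 ≤ k w := by
    intro t
    induction t using Finset.induction_on with
    | empty => exact ⟨x₀, k₀, h₀, hL₀, hR₀, hD₀, hb₁, hb₀, fun w hw => absurd hw (Finset.notMem_empty _)⟩
    | insert w₀ t hw₀ ih =>
      obtain ⟨x, k, h, hL, hR, hD, hb₁', hb₀', ht⟩ := ih
      by_cases hk : 0 ≤ k w₀
      · exact ⟨x, k, h, hL, hR, hD, hb₁', hb₀', fun w hw => by
          rcases Finset.mem_insert.1 hw with rfl | hw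
          · exact hk
          · exact ht w hw⟩
      · obtain ⟨h', hL', hR', hD', hb₁'', hb₀''⟩ := h.flip_step hτ hδf hL hR hD hb₁' hb₀' w₀
        refine ⟨_, _, h', hL', hR', hD', hb₁'', hb₀'', fun w hw => ?_⟩
        rcases Finset.mem_insert.1 hw with rfl | hw
        · rw [Function.update_self]; omega
        · rw [Function.update_of_ne (ne_of_mem_of_not_mem hw hw₀)]; exact ht w hw
  obtain ⟨x, k, h, hL, -, hD, hb₁', hb₀', hpos⟩ := key Finset.univ
  refine ⟨x, k, m₀, h, fun w => hpos w (Finset.mem_univ w), fun w hk => ?_, fun w hk => ?_, hL, hD⟩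
  · have hxb : w ∉ badZero hτ δf x k := by rw [hb₀']; exact Finset.notMem_empty _
    simp only [badZero, Finset.mem_filter, Finset.mem_univ, true_and, not_and, not_not] at hxb
    by_cases h1 : gardingAct hτ (δf w) x = x
    · exact Or.inl h1
    · exact Or.inr (hxb hk h1)
  · have hxb : w ∉ badOne hτ ℓ x k := by rw [hb₁']; exact Finset.notMem_empty _
    simp only [badOne, Finset.mem_filter, Finset.mem_univ, true_and, not_or, not_and, not_not] at hxb
    by_cases h0 : Ra[w] (Lo[w] x) = 0
    · exact Or.inr (hxb.1 hk h0)
    · exact Or.inl h0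

end Candidates

/-! ### 4. Existence of base candidates -/

section Existence

variable {hcpt : isCompact_glFiniteIntegralLevel 2 K}
  {E : Type*} [NormedAddCommGroup E] [InnerProductSpace ℂ E] [CompleteSpace E]
  {τ : ContRepresentation ℂ (AutomorphyDatum.gl 2 K hcpt).arch.carrier E}
  (hτ : τ.IsStronglyContinuous)

/-- **Base candidates exist** (`ArchKirillovTestVectorSelectionGL2.exists_baseVector`).
[cite: JacquetLanglands1970, §5 (Thm. 5.13), §6 (Thm. 6.4)] -/
theorem exists_isBaseCandidate (hτu : τ.IsUnitary) (hτi : τ.IsTopIrreducible)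
    {ℓ : archGardingSpace hcpt τ →ₗ[ℂ] ℂ} (hℓW : IsArchContWhittakerFunctional hcpt τ hτ ℓ) (hne : ℓ ≠ 0) :
    ∃ (x : archGardingSpace hcpt τ) (k : {w : InfinitePlace K // IsReal w} → ℤ) (m : {w : InfinitePlace K // IsComplex w} → ℕ),
      IsBaseCandidate hτ ℓ x k m := by
  obtain ⟨V, hVfd, hK, x, hxV, hxS, hW, hC⟩ := exists_baseVector hτ hτu hτi hℓW hne
  choose k hk using hW
  choose m hm using hC
  refine ⟨x, k, m, ⟨V, hVfd, hK, hxV⟩, hxS, hk, fun w => (hm w).1, fun w => ?_, fun w => (hm w).2.2.1, fun w => (hm w).2.2.2⟩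
  rw [← raising_eq_hol_sub_anti hτ w x]
  exact (hm w).2.1

/-- **Normal form of the base vector, absolute version** (`exists_isBaseCandidate` +
`exists_isBaseCandidate_normalForm`). [cite: JacquetLanglands1970, §5 (Thm. 5.13), §6 (Thm. 6.2–6.4)] -/
theorem exists_isBaseCandidate_normalForm' (hτu : τ.IsUnitary) (hτi : τ.IsTopIrreducible)
    {ℓ : archGardingSpace hcpt τ →ₗ[ℂ] ℂ} (hℓW : IsArchContWhittakerFunctional hcpt τ hτ ℓ) (hne : ℓ ≠ 0)
    {δf : {w : InfinitePlace K // IsReal w} → GL (Fin 2) (mixedSpace K)}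
    (hδf : ∀ w, (δf w : Matrix (Fin 2) (Fin 2) (mixedSpace K)) =
      1 - (2 : ℝ) • Matrix.single (0 : Fin 2) (0 : Fin 2) ((Pi.single w 1, 0) : mixedSpace K)) :
    ∃ (x : archGardingSpace hcpt τ) (k : {w : InfinitePlace K // IsReal w} → ℤ) (m : {w : InfinitePlace K // IsComplex w} → ℕ),
      IsBaseCandidate hτ ℓ x k m ∧ (∀ w, 0 ≤ k w) ∧
      (∀ w, k w = 0 → gardingAct hτ (δf w) x = x ∨ gardingAct hτ (δf w) x = -x) ∧
      (∀ w, k w = 1 →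
        (gardingEnd hτ (Matrix.single (0 : Fin 2) (0 : Fin 2) ((Pi.single w 1, 0) : mixedSpace K) -
              Matrix.single (1 : Fin 2) (1 : Fin 2) ((Pi.single w 1, 0) : mixedSpace K)) +
            Complex.I • gardingEnd hτ (Matrix.single (0 : Fin 2) (1 : Fin 2) ((Pi.single w 1, 0) : mixedSpace K) +
              Matrix.single (1 : Fin 2) (0 : Fin 2) ((Pi.single w 1, 0) : mixedSpace K)))
          ((gardingEnd hτ (Matrix.single (0 : Fin 2) (0 : Fin 2) ((Pi.single w 1, 0) : mixedSpace K) -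
              Matrix.single (1 : Fin 2) (1 : Fin 2) ((Pi.single w 1, 0) : mixedSpace K)) -
            Complex.I • gardingEnd hτ (Matrix.single (0 : Fin 2) (1 : Fin 2) ((Pi.single w 1, 0) : mixedSpace K) +
              Matrix.single (1 : Fin 2) (0 : Fin 2) ((Pi.single w 1, 0) : mixedSpace K))) x) ≠ 0 ∨
        (gardingEnd hτ (Matrix.single (0 : Fin 2) (0 : Fin 2) ((Pi.single w 1, 0) : mixedSpace K) -
              Matrix.single (1 : Fin 2) (1 : Fin 2) ((Pi.single w 1, 0) : mixedSpace K)) -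
            Complex.I • gardingEnd hτ (Matrix.single (0 : Fin 2) (1 : Fin 2) ((Pi.single w 1, 0) : mixedSpace K) +
              Matrix.single (1 : Fin 2) (0 : Fin 2) ((Pi.single w 1, 0) : mixedSpace K))) x ∈ kirillovNull hτ ℓ) ∧
      (∀ w, 2 ≤ k w →
        (gardingEnd hτ (Matrix.single (0 : Fin 2) (0 : Fin 2) ((Pi.single w 1, 0) : mixedSpace K) -
              Matrix.single (1 : Fin 2) (1 : Fin 2) ((Pi.single w 1, 0) : mixedSpace K)) -
            Complex.I • gardingEnd hτ (Matrix.single (0 : Fin 2) (1 : Fin 2) ((Pi.single w 1, 0) : mixedSpace K) +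
              Matrix.single (1 : Fin 2) (0 : Fin 2) ((Pi.single w 1, 0) : mixedSpace K))) x ∈ kirillovNull hτ ℓ) ∧
      (∀ w, 2 ≤ m w → descentOp hτ w (m w) x ∈ kirillovNull hτ ℓ) :=
  exists_isBaseCandidate_normalForm hτ hτu hτi hℓW hδf hne (exists_isBaseCandidate hτ hτu hτi hℓW hne)

end Existence

end Literature.NumberTheory.Automorphic
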